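import Literature.MathematicalPhysics.QuantumFieldTheory.Balaban1983to89.T4MaximalCoupling

/-!
# T⁴ programme, node NE7 (action-level member): a SUMMABLE DENSITY CHAIN of effective unit-lattice laws has a
# LIMITING LAW (total-variation limit with tail rate), and the continuum limit is its expectation functional

HONEST FRAMING (cell `pub-balaban`, T⁴ target (c): FINITE physical 4-torus, rung (B)+1 = the joint continuum limit of
unit-scale block-averaged Wilson-loop expectations; NO mass gap, NO infinite volume, NOT the Clay problem).  This module
is [folklore] measure theory over the interfaces of `T4VarianceMatching` (lineage t4-ne7-p3, the "variance /
second-moment route"); it discharges NOTHING of Balaban's estimates, and its hypotheses (`EffTiltRate` = NE7-A,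
`EffTiltRateGB` = NE7-A-prime, `EffDensityRate` = NE7-D, each with SUMMABLE rates) remain NOT PRINTED (GAPS G-ne7p3-7;
T4-REF-U5 F2: the print never compares two runs).  Value = kernel reduction: it records precisely WHAT the action-level
hypothesis buys, which is strictly more than the apex `Missing.HasContinuumLimit`.

WHAT IS PROVED (sorry-free, standard axioms).
* Section 1 (abstract, any measurable space). `DensityChain mu delta` := for every `K`, `mu (K+1) = g_K . mu K` with
  `g_K >= 0` measurable and `integral |g_K - 1| d(mu K) <= delta K`.  For probability measures with summable `delta`:
  the cumulative densities `rho_K = d(mu K)/d(mu 0)` (`DensityChain.dens`, `eq_withDensity_dens`) converge `mu 0`-a.e.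
  AND in `L1(mu 0)` to a density `rho_inf >= 0` with `integral rho_inf d(mu 0) = 1` and the TAIL BOUND
  `integral |rho_K - rho_inf| d(mu 0) <= Sum_{j >= K} delta_j` (`DensityChain.exists_limit_dens`); hence there is a
  probability measure `nu = rho_inf . mu 0`, `nu << mu 0`, with `|integral f d(mu K) - integral f d(nu)| <= B Sum_{j>=K} delta_j`
  for every measurable `|f| <= B` (`DensityChain.exists_limit_measure`).  The engine
  `exists_ae_limit_of_summable_lintegral` is the elementary "L1-summable increments => a.e. and L1 limit" argument
  (monotone convergence for `Sum_K lintegral ||rho_{K+1} - rho_K||`, a.e. absolute summability, termwise tail bound).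
* Section 2 (scheme level, `F : UnitFactorisation S X`). NE7-D / NE7-A / NE7-A-prime ARE density chains, with
  `delta_K = s_K + w_K + w'_K` / `2 e^{2R} sigma_K` / `4 e^{2R} sigma_K + 2 (w_K + w'_K)` — exactly the constants of
  `T4VarianceMatching` Sections 5 and 8 (`densityChain_of_effDensityRate`, `densityChain_of_effTiltRate`,
  `densityChain_of_effTiltRateGB`).  A summable chain gives THE LIMITING EFFECTIVE UNIT-LATTICE LAW `nu` on `X`,
  `nu << F.effLaw 0`, as a TOTAL-VARIATION limit at the tail rate for EVERY bounded measurable unit-lattice function,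
  not only for products of loop variables (`exists_limitLaw_of_densityChain`); the continuum limit IDENTIFIED as
  `lim_K <prod_o W_o>_K = integral prod_o W_o d(nu)` (`exists_limitLaw_tendsto_expectAt`); the apex
  (`hasContinuumLimit_of_densityChain`); and the three specialisations `exists_limitLaw_of_effTiltRate`,
  `exists_limitLaw_of_effTiltRateGB`, `exists_limitLaw_of_effDensityRate`.
* Section 3 (on the observable cube, through `T4LimitLaw`). The laws `law_K` of the clamped observable vector
  converge IN TOTAL VARIATION on `[-1,1]^O` to the push-forward `(wVec)_* nu`, at the tail rate
  (`exists_limitLaw_law_tv`) — an upgrade of the WEAK convergence that is equivalent to `HasContinuumLimit`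
  (`T4LimitLaw.hasContinuumLimit_iff_exists_tendsto_law`); for a countable observable class the unique limit law of
  `T4LimitLaw.existsUnique_limitLaw` IS `(wVec)_* nu`, and `law_K` converges to it (`exists_limitLaw_identified`).
  PRIORITY / OVERLAP (v2 note): the cube-side total-variation convergence `law_K -> limit` at a summable tail rate
  under the density / TV currencies of node U5 was FIRST recorded in the tree by `T4ContinuumLawTV` (lineage pv01:
  `continuumLaw_le_law_add_tail`, `law_le_continuumLaw_add_tail`, `tendsto_deficit_law_continuumLaw`, and the
  `EffDensityRate` corollaries with tail `Sum_{j>=K} (s_j + w_j + w'_j)/2` on sets), by a different route (maximal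
  coupling + one-sided set deviations, limit = `T4ContinuumLaw.continuumLaw`); Section 3 here re-derives that
  convergence by push-forward and ADDS only the identification of the limit as `(wVec)_* nu` with `nu << F.effLaw 0`
  a law on unit-lattice fields.  Sections 1, 2 and 4 (the law ON `X`, the `L1`/a.e. convergence of the effective
  densities, the tilt currencies, the carved currency) have no counterpart there.
* Section 4 (v2; one step of a chain and the node's CARVED two-run currency). One step of a density chain moves the
  expectation of a measurable `|f| <= B` by at most `B delta_K` (`DensityChain.abs_integral_succ_sub_le`), hence the
  log-moment generating function of a measurable `|g| <= B` by at most `e^{2B} delta_K`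
  (`abs_log_integral_exp_sub_le_of_tv`; both integrals are `>= e^{-B}`).  Consequently EVERY law currency that is a
  density chain gives the node's carved hybrid statement `T4CauchySum.MatchingModConstants 1 l0 (e^{2 l0} delta)
  (schemeZ S os)` with the constants `c_K = log Z_{K+1}(0) - log Z_K(0)` only (`matchingModConstants_of_densityChain`)
  and node U0's input `T4Assembly.GenFunCauchy S l0` when `Sum delta_K < infinity` (`genFunCauchy_of_densityChain`):
  in particular the plain density rate NE7-D (`matchingModConstants_of_effDensityRate`,
  `genFunCauchy_of_effDensityRate`; not covered by `T4VarianceMatching` Section 9), and the tilt currencies with the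
  alternative remainders `2 e^{2R + 2 l0} sigma_K` (NE7-A, `matchingModConstants_of_effTiltRate'`) and
  `e^{2 l0} (4 e^{2R} sigma_K + 2 (w_K + w'_K))` with NO smallness condition on `w'` (NE7-A-prime,
  `matchingModConstants_of_effTiltRateGB'`, `genFunCauchy_of_effTiltRateGB'`; `T4VarianceMatching` Section 9 needs
  `w'_K <= 1/2` there).
* Section 5 (v2; abstract TV chains). The WEAKEST law-level currency needs no densities between consecutive laws:
  `TVChain mu t` := `t_K >= 0` and `mu K A <= mu (K+1) A + t_K` for every measurable `A` (the shape of pv01's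
  `T4MaximalCoupling.EffTVRate`).  With the common dominating probability measure `domMeasure mu = Sum_K 2^{-(K+1)} mu K`
  and the real Radon-Nikodym densities `rnDens mu K = d(mu K)/d(domMeasure mu)` (Mathlib `Measure.rnDeriv`): the
  one-sided set bound is two-sided between probability measures (`measure_le_add_ofReal_of_forall`), the densities
  satisfy `lintegral ||r_{K+1} - r_K|| d(domMeasure) <= 2 t_K` (`TVChain.lintegral_enorm_rnDens_sub_le`, split at
  `{r_K < r_{K+1}}`), one step moves bounded expectations by `<= B 2 t_K` (`TVChain.abs_integral_succ_sub_le`), and the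
  generic engine `exists_limit_measure_of_withDensity` (Section 1's argument for densities with respect to ANY fixed
  base) gives, for `Sum t_K < infinity`, a limiting probability measure `nu << domMeasure mu` with
  `|integral f d(mu K) - integral f d(nu)| <= B Sum_{j>=K} 2 t_j` (`TVChain.exists_limit_measure`).  A density chain is
  a TV chain with the same rates (`DensityChain.tvChain`).
* Section 6 (v2; scheme level, NE7-TV). `T4MaximalCoupling.EffTVRate F t` IS a TV chain of the effective laws
  (`tvChain_of_effTVRate`, definitional; conversely every density chain of effective laws is an `EffTVRate`,
  `effTVRate_of_densityChain`).  With `Sum t_K < infinity`: the limiting effective unit-lattice law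
  (`exists_limitLaw_of_effTVRate`; here `nu << domMeasure F.effLaw`, absolute continuity with respect to `F.effLaw 0`
  is not claimed in this currency), the continuum limit of every string identified
  (`exists_limitLaw_tendsto_expectAt_of_effTVRate`), the carved NE7 with remainder `e^{2 l0} 2 t_K`
  (`matchingModConstants_of_effTVRate`) and `GenFunCauchy S l0` (`genFunCauchy_of_effTVRate`).  The apex from
  `EffTVRate` (via maximal coupling and transport) and the cube-side TV convergence are pv01's
  (`T4MaximalCoupling`, `T4ContinuumLawTV`); what is added is the law ON `X` and the action-level consequences.
* Section 7 (v2; representation by tail bounds). ANY measure `nu` with `|integral g d(effLaw K) - integral g d(nu)| <=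
  B a_K` for bounded measurable `g` and `a_K -> 0` (the shape of the conclusions of Sections 2, 5, 6) represents the
  string limits (`tendsto_expectAt_of_tail`), gives `HasContinuumLimit S` (`hasContinuumLimit_of_tail`) and, for
  countable `O`, the weak limit `law_K -> (wVec)_* nu` (`tendsto_law_of_tail`); two probability measures with such tail
  bounds are EQUAL (`eq_of_tail`) — the limiting law does not depend on the currency that produced it.

WHY THIS IS WORTH RECORDING.  `HasContinuumLimit S` is the convergence of countably many bounded real sequences.  Under
NE7-A / NE7-A-prime / NE7-D with summable rates one gets a genuine PROBABILITY MEASURE on unit-lattice fields — the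
"continuum effective theory on the unit lattice" as a LAW `nu << rho_0 dV` — together with `L1` convergence of the
effective densities, which is the natural meaning of "the fully renormalised effective densities converge as the bare
cutoff is removed".  In Balaban's language (see `T4RunLadder.unitFactorisation`: `X` = unit-lattice gauge fields,
`A_K = unitShift o avg^K`, `F.effLaw K` = the law `rho_K dV` after `K` complete renormalisation steps):
`Sum_K integral |rho_{K+1}/rho_K - 1| rho_K dV < infinity  =>  rho_K -> rho_inf in L1(rho_0 dV)`, and every bounded
unit-lattice observable — gauge-invariant or not, loop product or not — has a continuum limit, given by `nu`.

WHAT IS NOT PROVED.  Any instance of `DensityChain F.effLaw delta` (or of the weaker `EffTVRate F t`) with summable rates for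
Balaban's data (this is NE7 in density / total-variation currency: NOT PRINTED, no printed theorem compares the laws of two runs); gauge invariance,
reflection positivity or any OS property of `nu`; anything at infinite volume or about a mass gap.  (Uniqueness of
`nu` as a tail limit: Section 7; Section 3 identifies its push-forward to the cube.)  Nothing here is a step of Balaban's papers; the papers under audit are not cited for anything.

Depends on: `T4MaximalCoupling` (pv01; `EffTVRate` only — Section 6), `T4VarianceMatching` (Sections 4-5: `UnitFactorisation`, `effLaw`, `isProbabilityMeasure_effLaw`,
`EffDensityRate`, `integral_abs_sub_one_le_of_goodBad`, `integral_withDensity_ofReal_mul`, `integral_density_eq_one`,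
`expectAt_eq_integral_effLaw`, `toMeasure_law_eq_map`, `abs_obs_le_one`, `measurable_wVec`; Section 8:
`Tilt.tiltDensity`, `Tilt.tilted_eq_withDensity_tiltDensity`, `Tilt.measurable_tiltDensity`, `Tilt.tiltDensity_pos`,
`Tilt.integral_abs_tiltDensity_sub_one_le'`, `Tilt.integral_abs_sub_one_le_of_tilt_goodBad`, `EffTiltRate`,
`EffTiltRateGB`; Section 9: `UnitFactorisation.genFun_schemeZ_eq_log_integral_effLaw`), `T4Assembly`
(`genFunCauchy_of_matchingModConstants`), `T4CauchySum` (`MatchingModConstants`, `genFun`), `T4LimitLaw` (`law`, `monomial`, `measurable_monomial`, `abs_monomial_le_one`,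
`existsUnique_limitLaw`, `exists_tendsto_law_of_hasContinuumLimit`), Mathlib (`Measure.withDensity`, `withDensity_mul`,
`Measure.sum`, `Measure.rnDeriv`, `Measure.withDensity_rnDeriv_eq`, `Measure.integrable_toReal_rnDeriv`, `ENNReal.tsum_geometric`,
`lintegral_tsum`, `Measurable.tsum`, `nnnorm_tsum_le`, `Summable.sum_add_tsum_nat_add`, `tendsto_sum_nat_add`).
Cell records: `t4/T4-EST-NE7-P3.md` Sections 21-23 (v2: Section 23); GAPS G-ne7p3-7 (the missing input, unchanged) and C-ne7p3-8 (this
module's reduction).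
-/

noncomputable section

namespace Literature.MathematicalPhysics.QuantumFieldTheory.Balaban1983to89.T4EffectiveLawLimit

open MeasureTheory Filter Topology
open scoped ENNReal Topology BigOperators
open T4VarianceMatching Missing T4Continuum T4LimitLaw

/-! ## §1 Abstract: an L¹-summable chain of densities has a limit density (total-variation limit with tail rate) -/

section Abstract

variable {α : Type*} [MeasurableSpace α]

/-- **A.E. LIMIT WITH L¹ TAIL BOUND** for a sequence of measurable real functions whose consecutive differences have
summable `L¹(μ₀)` norms: there is a measurable `ρ∞` with `ρ_K → ρ∞` `μ₀`-a.e. and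
`∫⁻ ‖ρ_K − ρ∞‖ₑ dμ₀ ≤ Σ_j e_{j+K}`. [folklore] -/
theorem exists_ae_limit_of_summable_lintegral (μ₀ : Measure α) (ρ : ℕ → α → ℝ) (hρm : ∀ K, Measurable (ρ K))
    (e : ℕ → ℝ≥0∞) (he : ∀ K, ∫⁻ x, ‖ρ (K + 1) x - ρ K x‖ₑ ∂μ₀ ≤ e K) (hes : ∑' K, e K ≠ ∞) :
    ∃ ρinf : α → ℝ, Measurable ρinf ∧ (∀ᵐ x ∂μ₀, Tendsto (fun K => ρ K x) atTop (𝓝 (ρinf x))) ∧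
      ∀ K, ∫⁻ x, ‖ρ K x - ρinf x‖ₑ ∂μ₀ ≤ ∑' j, e (j + K) := by
  -- the increments, kept opaque
  obtain ⟨d, hd⟩ : ∃ d : ℕ → α → ℝ, ∀ K x, d K x = ρ (K + 1) x - ρ K x :=
    ⟨fun K x => ρ (K + 1) x - ρ K x, fun _ _ => rfl⟩
  have hdm : ∀ K, Measurable (d K) := fun K => by
    have hK : d K = fun x => ρ (K + 1) x - ρ K x := funext (hd K)
    rw [hK]
    exact (hρm (K + 1)).sub (hρm K)
  have hdme : ∀ K, Measurable fun x => ‖d K x‖ₑ := fun K => (hdm K).enorm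
  have he' : ∀ K, ∫⁻ x, ‖d K x‖ₑ ∂μ₀ ≤ e K := fun K => by simpa only [hd] using he K
  have hSm : Measurable fun x => ∑' K, ‖d K x‖ₑ := Measurable.tsum (f := fun K x => ‖d K x‖ₑ) hdme
  have hS_int : ∫⁻ x, ∑' K, ‖d K x‖ₑ ∂μ₀ ≤ ∑' K, e K := by
    rw [lintegral_tsum fun K => (hdme K).aemeasurable]
    exact ENNReal.tsum_le_tsum he'
  have hS_fin : ∀ᵐ x ∂μ₀, ∑' K, ‖d K x‖ₑ < ∞ := ae_lt_top hSm (ne_top_of_le_ne_top hes hS_int)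
  -- a.e. summability of the norms of the real increments
  have hsum : ∀ᵐ x ∂μ₀, Summable fun K => ‖d K x‖₊ := by
    filter_upwards [hS_fin] with x hx
    exact ENNReal.tsum_coe_ne_top_iff_summable.mp hx.ne
  -- partial sums
  have hps : ∀ x K, ∑ i ∈ Finset.range K, d i x = ρ K x - ρ 0 x := fun x K => by
    simp only [hd]
    exact Finset.sum_range_sub (fun i => ρ i x) K
  -- the limit
  refine ⟨fun x => ρ 0 x + ∑' K, d K x, (hρm 0).add (Measurable.tsum (f := d) hdm), ?_, ?_⟩
  · filter_upwards [hsum] with x hx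
    have hds : Summable fun K => d K x := (NNReal.summable_coe.mpr hx).of_norm
    have ht : Tendsto (fun K => ∑ i ∈ Finset.range K, d i x) atTop (𝓝 (∑' K, d K x)) :=
      hds.hasSum.tendsto_sum_nat
    have heq : (fun K => ρ K x) = fun K => ρ 0 x + ∑ i ∈ Finset.range K, d i x := by
      funext K
      rw [hps x K]
      ring
    rw [heq]
    exact tendsto_const_nhds.add ht
  · intro K
    have htail : ∀ᵐ x ∂μ₀, ‖ρ K x - (ρ 0 x + ∑' j, d j x)‖ₑ ≤ ∑' j, ‖d (j + K) x‖ₑ := by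
      filter_upwards [hsum] with x hx
      have hds : Summable fun j => d j x := (NNReal.summable_coe.mpr hx).of_norm
      have hshift : Summable fun j => ‖d (j + K) x‖₊ := (NNReal.summable_nat_add_iff K).mpr hx
      have hdecomp : ρ K x - (ρ 0 x + ∑' j, d j x) = -∑' j, d (j + K) x := by
        have h1 := hds.sum_add_tsum_nat_add K
        have h2 := hps x K
        linarith
      rw [hdecomp, enorm_neg]
      calc ‖∑' j, d (j + K) x‖ₑ = ((‖∑' j, d (j + K) x‖₊ : NNReal) : ℝ≥0∞) := rfl
        _ ≤ ((∑' j, ‖d (j + K) x‖₊ : NNReal) : ℝ≥0∞) := ENNReal.coe_le_coe.mpr (nnnorm_tsum_le hshift)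
        _ = ∑' j, ((‖d (j + K) x‖₊ : NNReal) : ℝ≥0∞) := ENNReal.coe_tsum hshift
        _ = ∑' j, ‖d (j + K) x‖ₑ := rfl
    calc ∫⁻ x, ‖ρ K x - (ρ 0 x + ∑' j, d j x)‖ₑ ∂μ₀
        ≤ ∫⁻ x, ∑' j, ‖d (j + K) x‖ₑ ∂μ₀ := lintegral_mono_ae htail
      _ = ∑' j, ∫⁻ x, ‖d (j + K) x‖ₑ ∂μ₀ := lintegral_tsum fun j => (hdme (j + K)).aemeasurable
      _ ≤ ∑' j, e (j + K) := ENNReal.tsum_le_tsum fun j => he' (j + K)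

/-- **DENSITY CHAIN (hypothesis shape)**: `μ_{K+1} = g_K · μ_K` with a measurable `g_K ≥ 0` whose `L¹(μ_K)`-distance
to `1` is at most `δ_K`.  The three unit-lattice law currencies of `T4VarianceMatching` with a density (§5 density
NE7-D, §8 Gibbs tilt NE7-A, good/bad Gibbs tilt NE7-A′) are instances (§2 below). [folklore] -/
def DensityChain (μ : ℕ → Measure α) (δ : ℕ → ℝ) : Prop :=
  ∀ K : ℕ, ∃ g : α → ℝ, Measurable g ∧ (∀ x, 0 ≤ g x) ∧
    μ (K + 1) = (μ K).withDensity (fun x => ENNReal.ofReal (g x)) ∧ ∫ x, |g x - 1| ∂(μ K) ≤ δ K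

namespace DensityChain

variable {μ : ℕ → Measure α} {δ : ℕ → ℝ}

/-- The chosen one-step densities. [folklore] -/
def step (h : DensityChain μ δ) (K : ℕ) : α → ℝ := (h K).choose

/-- [folklore] -/
theorem measurable_step (h : DensityChain μ δ) (K : ℕ) : Measurable (h.step K) := (h K).choose_spec.1

/-- [folklore] -/
theorem step_nonneg (h : DensityChain μ δ) (K : ℕ) (x : α) : 0 ≤ h.step K x := (h K).choose_spec.2.1 x

/-- [folklore] -/
theorem succ_eq (h : DensityChain μ δ) (K : ℕ) :
    μ (K + 1) = (μ K).withDensity (fun x => ENNReal.ofReal (h.step K x)) :=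
  (h K).choose_spec.2.2.1

/-- [folklore] -/
theorem integral_abs_step_sub_one_le (h : DensityChain μ δ) (K : ℕ) : ∫ x, |h.step K x - 1| ∂(μ K) ≤ δ K :=
  (h K).choose_spec.2.2.2

/-- [folklore] -/
theorem delta_nonneg (h : DensityChain μ δ) (K : ℕ) : 0 ≤ δ K :=
  (integral_nonneg fun _ => abs_nonneg _).trans (h.integral_abs_step_sub_one_le K)

/-- The cumulative densities with respect to `μ 0`: `ρ_0 = 1`, `ρ_{K+1} = ρ_K · g_K`. [folklore] -/
def dens (h : DensityChain μ δ) : ℕ → α → ℝ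
  | 0 => fun _ => 1
  | K + 1 => fun x => dens h K x * h.step K x

/-- [folklore] -/
theorem dens_zero (h : DensityChain μ δ) : h.dens 0 = fun _ => 1 := rfl

/-- [folklore] -/
theorem dens_succ (h : DensityChain μ δ) (K : ℕ) : h.dens (K + 1) = fun x => h.dens K x * h.step K x := rfl

/-- [folklore] -/
theorem measurable_dens (h : DensityChain μ δ) : ∀ K, Measurable (h.dens K)
  | 0 => measurable_const
  | K + 1 => (measurable_dens h K).mul (h.measurable_step K)

/-- [folklore] -/
theorem dens_nonneg (h : DensityChain μ δ) : ∀ K x, 0 ≤ h.dens K x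
  | 0, _ => zero_le_one
  | K + 1, x => mul_nonneg (dens_nonneg h K x) (h.step_nonneg K x)

/-- `μ_K = ρ_K · μ_0`. [folklore] -/
theorem eq_withDensity_dens (h : DensityChain μ δ) :
    ∀ K, μ K = (μ 0).withDensity (fun x => ENNReal.ofReal (h.dens K x))
  | 0 => by simp [dens_zero]
  | K + 1 => by
      rw [h.succ_eq K, eq_withDensity_dens h K,
        ← withDensity_mul _ (Measurable.ennreal_ofReal (h.measurable_dens K))
          (Measurable.ennreal_ofReal (h.measurable_step K))]
      congr 1
      funext x
      simp only [Pi.mul_apply, dens_succ, ENNReal.ofReal_mul (h.dens_nonneg K x)]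

/-- [folklore] -/
theorem lintegral_dens (h : DensityChain μ δ) (K : ℕ) [IsProbabilityMeasure (μ K)] :
    ∫⁻ x, ENNReal.ofReal (h.dens K x) ∂(μ 0) = 1 := by
  have h1 : (μ K) Set.univ = 1 := measure_univ
  rw [h.eq_withDensity_dens K, withDensity_apply _ MeasurableSet.univ, Measure.restrict_univ] at h1
  exact h1

/-- [folklore] -/
theorem integrable_dens (h : DensityChain μ δ) (K : ℕ) [IsProbabilityMeasure (μ K)] :
    Integrable (h.dens K) (μ 0) := by
  refine ⟨(h.measurable_dens K).aestronglyMeasurable, ?_⟩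
  rw [hasFiniteIntegral_iff_ofReal (ae_of_all _ (h.dens_nonneg K)), h.lintegral_dens K]
  exact ENNReal.one_lt_top

/-- [folklore] -/
theorem integral_dens (h : DensityChain μ δ) (K : ℕ) [IsProbabilityMeasure (μ K)] :
    ∫ x, h.dens K x ∂(μ 0) = 1 := by
  have h1 := h.lintegral_dens K
  rw [← ofReal_integral_eq_lintegral_ofReal (h.integrable_dens K) (ae_of_all _ (h.dens_nonneg K))] at h1
  have h2 : 0 ≤ ∫ x, h.dens K x ∂(μ 0) := integral_nonneg (h.dens_nonneg K)
  have h3 := congrArg ENNReal.toReal h1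
  rwa [ENNReal.toReal_ofReal h2, ENNReal.toReal_one] at h3

/-- [folklore] -/
theorem integrable_step (h : DensityChain μ δ) (K : ℕ) [IsProbabilityMeasure (μ (K + 1))] :
    Integrable (h.step K) (μ K) := by
  refine ⟨(h.measurable_step K).aestronglyMeasurable, ?_⟩
  rw [hasFiniteIntegral_iff_ofReal (ae_of_all _ (h.step_nonneg K))]
  have h1 : (μ (K + 1)) Set.univ = 1 := measure_univ
  rw [h.succ_eq K, withDensity_apply _ MeasurableSet.univ, Measure.restrict_univ] at h1
  rw [h1]
  exact ENNReal.one_lt_top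

/-- **The consecutive `L¹(μ_0)` increments are at most `δ_K`**: `∫ |ρ_{K+1} − ρ_K| dμ_0 = ∫ |g_K − 1| dμ_K ≤ δ_K`.
[folklore] -/
theorem lintegral_enorm_dens_sub_le (h : DensityChain μ δ) (K : ℕ) [IsProbabilityMeasure (μ K)]
    [IsProbabilityMeasure (μ (K + 1))] :
    ∫⁻ x, ‖h.dens (K + 1) x - h.dens K x‖ₑ ∂(μ 0) ≤ ENNReal.ofReal (δ K) := by
  have hpt : ∀ x, ‖h.dens (K + 1) x - h.dens K x‖ₑ = ENNReal.ofReal (h.dens K x) * ‖h.step K x - 1‖ₑ := by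
    intro x
    have hx : h.dens (K + 1) x - h.dens K x = h.dens K x * (h.step K x - 1) := by
      rw [dens_succ]; ring
    rw [hx, enorm_mul, Real.enorm_eq_ofReal (h.dens_nonneg K x)]
  simp_rw [hpt]
  have hF : Measurable fun x => ENNReal.ofReal (h.dens K x) := (h.measurable_dens K).ennreal_ofReal
  have hG : Measurable fun x => ‖h.step K x - 1‖ₑ := ((h.measurable_step K).sub measurable_const).enorm
  have key : ∫⁻ x, ENNReal.ofReal (h.dens K x) * ‖h.step K x - 1‖ₑ ∂(μ 0) = ∫⁻ x, ‖h.step K x - 1‖ₑ ∂(μ K) := by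
    rw [h.eq_withDensity_dens K, lintegral_withDensity_eq_lintegral_mul _ hF hG]
    rfl
  have hint : Integrable (fun x => h.step K x - 1) (μ K) := (h.integrable_step K).sub (integrable_const _)
  rw [key, ← ofReal_integral_norm_eq_lintegral_enorm hint]
  exact ENNReal.ofReal_le_ofReal (by simpa only [Real.norm_eq_abs] using h.integral_abs_step_sub_one_le K)

/-- **THE LIMIT DENSITY**: for a density chain of probability measures with `Σ δ_K < ∞` there is a measurable
`ρ∞ ≥ 0` with `∫ ρ∞ dμ_0 = 1`, `ρ_K → ρ∞` `μ_0`-a.e., and `∫ |ρ_K − ρ∞| dμ_0 ≤ Σ_j δ_{j+K}`. [folklore] -/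
theorem exists_limit_dens (h : DensityChain μ δ) [∀ K, IsProbabilityMeasure (μ K)] (hδ : Summable δ) :
    ∃ ρinf : α → ℝ, Measurable ρinf ∧ (∀ x, 0 ≤ ρinf x) ∧ Integrable ρinf (μ 0) ∧
      ∫ x, ρinf x ∂(μ 0) = 1 ∧ (∀ᵐ x ∂(μ 0), Tendsto (fun K => h.dens K x) atTop (𝓝 (ρinf x))) ∧
      ∀ K, ∫ x, |h.dens K x - ρinf x| ∂(μ 0) ≤ ∑' j, δ (j + K) := by
  have hes : ∑' K, ENNReal.ofReal (δ K) ≠ ∞ := by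
    rw [← ENNReal.ofReal_tsum_of_nonneg h.delta_nonneg hδ]
    exact ENNReal.ofReal_ne_top
  obtain ⟨ρ₁, hρ₁m, hlim₁, htail₁⟩ := exists_ae_limit_of_summable_lintegral (μ 0) h.dens h.measurable_dens
    (fun K => ENNReal.ofReal (δ K)) (fun K => h.lintegral_enorm_dens_sub_le K) hes
  -- the nonnegative version `max ρ₁ 0`
  have hρm : Measurable fun x => max (ρ₁ x) 0 := hρ₁m.max measurable_const
  have hnn₁ : ∀ᵐ x ∂(μ 0), 0 ≤ ρ₁ x := by
    filter_upwards [hlim₁] with x hx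
    exact ge_of_tendsto' hx fun K => h.dens_nonneg K x
  have hae : ∀ᵐ x ∂(μ 0), max (ρ₁ x) 0 = ρ₁ x := by
    filter_upwards [hnn₁] with x hx
    exact max_eq_left hx
  have hshift : ∀ K, Summable fun j => δ (j + K) := fun K => (summable_nat_add_iff K).mpr hδ
  have htail : ∀ K, ∫⁻ x, ‖h.dens K x - max (ρ₁ x) 0‖ₑ ∂(μ 0) ≤ ENNReal.ofReal (∑' j, δ (j + K)) := by
    intro K
    rw [ENNReal.ofReal_tsum_of_nonneg (fun j => h.delta_nonneg (j + K)) (hshift K)]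
    calc ∫⁻ x, ‖h.dens K x - max (ρ₁ x) 0‖ₑ ∂(μ 0) = ∫⁻ x, ‖h.dens K x - ρ₁ x‖ₑ ∂(μ 0) := by
          refine lintegral_congr_ae ?_
          filter_upwards [hae] with x hx
          rw [hx]
      _ ≤ ∑' j, ENNReal.ofReal (δ (j + K)) := htail₁ K
  have hint_diff : ∀ K, Integrable (fun x => h.dens K x - max (ρ₁ x) 0) (μ 0) := fun K =>
    ⟨((h.measurable_dens K).sub hρm).aestronglyMeasurable, lt_of_le_of_lt (htail K) ENNReal.ofReal_lt_top⟩
  have hint : Integrable (fun x => max (ρ₁ x) 0) (μ 0) := by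
    have h0 := (h.integrable_dens 0).sub (hint_diff 0)
    refine h0.congr (ae_of_all _ fun x => ?_)
    simp only [Pi.sub_apply, sub_sub_cancel]
  have hL1 : ∀ K, ∫ x, |h.dens K x - max (ρ₁ x) 0| ∂(μ 0) ≤ ∑' j, δ (j + K) := by
    intro K
    have h0 : 0 ≤ ∑' j, δ (j + K) := tsum_nonneg fun j => h.delta_nonneg (j + K)
    have h1 : ∫ x, |h.dens K x - max (ρ₁ x) 0| ∂(μ 0) = (∫⁻ x, ‖h.dens K x - max (ρ₁ x) 0‖ₑ ∂(μ 0)).toReal := by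
      rw [← ofReal_integral_norm_eq_lintegral_enorm (hint_diff K),
        ENNReal.toReal_ofReal (integral_nonneg fun x => norm_nonneg _)]
      simp only [Real.norm_eq_abs]
    rw [h1]
    exact ENNReal.toReal_le_of_le_ofReal h0 (htail K)
  have hone : ∫ x, max (ρ₁ x) 0 ∂(μ 0) = 1 := by
    have hb : ∀ K, |1 - ∫ x, max (ρ₁ x) 0 ∂(μ 0)| ≤ ∑' j, δ (j + K) := by
      intro K
      calc |1 - ∫ x, max (ρ₁ x) 0 ∂(μ 0)|
          = |∫ x, (h.dens K x - max (ρ₁ x) 0) ∂(μ 0)| := by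
            rw [integral_sub (h.integrable_dens K) hint, h.integral_dens K]
        _ ≤ ∫ x, |h.dens K x - max (ρ₁ x) 0| ∂(μ 0) := abs_integral_le_integral_abs
        _ ≤ ∑' j, δ (j + K) := hL1 K
    have ht : Tendsto (fun K => ∑' j, δ (j + K)) atTop (𝓝 0) := tendsto_sum_nat_add δ
    have hle : |1 - ∫ x, max (ρ₁ x) 0 ∂(μ 0)| ≤ 0 := ge_of_tendsto' ht hb
    have h0 : 1 - ∫ x, max (ρ₁ x) 0 ∂(μ 0) = 0 := abs_eq_zero.mp (le_antisymm hle (abs_nonneg _))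
    linarith
  refine ⟨fun x => max (ρ₁ x) 0, hρm, fun x => le_max_right _ _, hint, hone, ?_, hL1⟩
  filter_upwards [hlim₁, hae] with x hx hx'
  rw [hx']
  exact hx

/-- **THE LIMIT MEASURE (total-variation limit with tail rate)**: for a density chain of probability measures with
`Σ δ_K < ∞` there is a probability measure `ν ≪ μ_0` with `|∫ f dμ_K − ∫ f dν| ≤ B · Σ_j δ_{j+K}` for every
measurable `|f| ≤ B` and every `K` — i.e. `μ_K → ν` in total variation at the tail rate. [folklore] -/
theorem exists_limit_measure (h : DensityChain μ δ) [∀ K, IsProbabilityMeasure (μ K)] (hδ : Summable δ) :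
    ∃ ν : Measure α, IsProbabilityMeasure ν ∧ ν ≪ μ 0 ∧
      ∀ (K : ℕ) (B : ℝ) (f : α → ℝ), Measurable f → (∀ x, |f x| ≤ B) →
        |∫ x, f x ∂(μ K) - ∫ x, f x ∂ν| ≤ B * ∑' j, δ (j + K) := by
  obtain ⟨ρinf, hρm, hρ0, hint, hone, -, hL1⟩ := h.exists_limit_dens hδ
  refine ⟨(μ 0).withDensity (fun x => ENNReal.ofReal (ρinf x)), ⟨?_⟩, withDensity_absolutelyContinuous _ _, ?_⟩
  · rw [withDensity_apply _ MeasurableSet.univ, Measure.restrict_univ,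
      ← ofReal_integral_eq_lintegral_ofReal hint (ae_of_all _ hρ0), hone, ENNReal.ofReal_one]
  · intro K B f hf hB
    have hB0 : 0 ≤ B := by
      rcases isEmpty_or_nonempty α with hα | ⟨⟨x⟩⟩
      · have h1 : (μ 0) Set.univ = 1 := measure_univ
        rw [Set.univ_eq_empty_iff.mpr hα, measure_empty] at h1
        exact absurd h1 zero_ne_one
      · exact (abs_nonneg _).trans (hB x)
    have hfb : ∀ᵐ x ∂(μ 0), ‖f x‖ ≤ B := ae_of_all _ fun x => by rw [Real.norm_eq_abs]; exact hB x
    have hi1 : Integrable (fun x => h.dens K x * f x) (μ 0) := (h.integrable_dens K).mul_bdd hf.aestronglyMeasurable hfb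
    have hi2 : Integrable (fun x => ρinf x * f x) (μ 0) := hint.mul_bdd hf.aestronglyMeasurable hfb
    have hi3 : Integrable (fun x => B * |h.dens K x - ρinf x|) (μ 0) :=
      ((h.integrable_dens K).sub hint).abs.const_mul B
    rw [h.eq_withDensity_dens K, integral_withDensity_ofReal_mul (h.measurable_dens K) (h.dens_nonneg K) f,
      integral_withDensity_ofReal_mul hρm hρ0 f, ← integral_sub hi1 hi2]
    calc |∫ x, (h.dens K x * f x - ρinf x * f x) ∂(μ 0)|
        ≤ ∫ x, |h.dens K x * f x - ρinf x * f x| ∂(μ 0) := abs_integral_le_integral_abs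
      _ ≤ ∫ x, B * |h.dens K x - ρinf x| ∂(μ 0) := by
          refine integral_mono_of_nonneg (ae_of_all _ fun x => abs_nonneg _) hi3 (ae_of_all _ fun x => ?_)
          show |h.dens K x * f x - ρinf x * f x| ≤ B * |h.dens K x - ρinf x|
          rw [← sub_mul, abs_mul, mul_comm]
          exact mul_le_mul_of_nonneg_right (hB x) (abs_nonneg _)
      _ = B * ∫ x, |h.dens K x - ρinf x| ∂(μ 0) := integral_const_mul _ _
      _ ≤ B * ∑' j, δ (j + K) := mul_le_mul_of_nonneg_left (hL1 K) hB0

end DensityChain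

end Abstract

/-! ## §2 The unit-lattice law currencies of `T4VarianceMatching` are density chains; the limiting effective law -/

section Scheme

variable {G : Type*} {O : Type*} {S : TorusScheme G O} [MeasurableSpace G] {X : Type*} [MeasurableSpace X]
  (F : UnitFactorisation S X) [GaugeGroup G] [HaarData G] [RegularGaugeGroup G]

/-- **NE7-D (§5 density rate) is a density chain** with `δ_K = s_K + w_K + w'_K`. [folklore] -/
theorem densityChain_of_effDensityRate (hβ : ∀ K, 0 ≤ S.β K) {s w w' : ℕ → ℝ}
    (h : F.EffDensityRate s w w') : DensityChain F.effLaw (fun K => s K + w K + w' K) := by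
  intro K
  obtain ⟨g, Gd, hgm, hg0, hgi, heq, hGd, hs0, hs, hw, hw'⟩ := h K
  haveI := F.isProbabilityMeasure_effLaw hβ K
  exact ⟨g, hgm, hg0, heq, integral_abs_sub_one_le_of_goodBad hg0 hgi hGd hs0 hs hw hw'⟩

/-- **NE7-A (§8 Gibbs-tilt rate) is a density chain** with `δ_K = 2e^{2R} σ_K` (the mean tilt modulus
`Tilt.integral_abs_tiltDensity_sub_one_le'`). [folklore] -/
theorem densityChain_of_effTiltRate (hβ : ∀ K, 0 ≤ S.β K) {R : ℝ} {σ : ℕ → ℝ}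
    (h : F.EffTiltRate R σ) : DensityChain F.effLaw (fun K => 2 * Real.exp (2 * R) * σ K) := by
  intro K
  obtain ⟨f, κ, hf, hR, heq, hσ⟩ := h K
  haveI := F.isProbabilityMeasure_effLaw hβ K
  refine ⟨Tilt.tiltDensity (F.effLaw K) f, Tilt.measurable_tiltDensity hf,
    fun u => (Tilt.tiltDensity_pos hf hR u).le, ?_, ?_⟩
  · rw [heq, Tilt.tilted_eq_withDensity_tiltDensity]
  · exact (Tilt.integral_abs_tiltDensity_sub_one_le' hf hR κ).trans
      (mul_le_mul_of_nonneg_left hσ (by positivity))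

/-- **NE7-A′ (§8 good/bad Gibbs-tilt rate) is a density chain** with `δ_K = 4e^{2R} σ_K + 2(w_K + w'_K)`
(`Tilt.integral_abs_sub_one_le_of_tilt_goodBad`). [folklore] -/
theorem densityChain_of_effTiltRateGB (hβ : ∀ K, 0 ≤ S.β K) {R : ℝ} {σ w w' : ℕ → ℝ}
    (h : F.EffTiltRateGB R σ w w') :
    DensityChain F.effLaw (fun K => 4 * Real.exp (2 * R) * σ K + 2 * (w K + w' K)) := by
  intro K
  obtain ⟨g, hh, C, Gd, hgm, hhm, hg0, hgi, heq, hGd, hC, hgh, hR, hσ, hw, hw2, hw'⟩ := h K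
  haveI := F.isProbabilityMeasure_effLaw hβ K
  haveI : IsProbabilityMeasure ((F.effLaw K).withDensity fun u => ENNReal.ofReal (g u)) := by
    rw [← heq]; exact F.isProbabilityMeasure_effLaw hβ (K + 1)
  have hg1 : ∫ u, g u ∂(F.effLaw K) = 1 := integral_density_eq_one hgm hg0
  exact ⟨g, hgm, hg0, heq,
    Tilt.integral_abs_sub_one_le_of_tilt_goodBad hg0 hgi hg1 hGd hhm hC hgh hR hσ hw hw2 hw'⟩

/-- **THE LIMITING EFFECTIVE UNIT-LATTICE LAW.**  If the effective laws form a density chain with `Σ δ_K < ∞`, they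
converge IN TOTAL VARIATION to a probability measure `ν` on the unit-lattice space `X`, absolutely continuous with
respect to the first effective law, at the tail rate: `|∫ g dρ_K dV − ∫ g dν| ≤ B · Σ_{j ≥ K} δ_j` for every
bounded measurable unit-lattice function `g`, `|g| ≤ B` — not only for products of loop variables. [folklore] -/
theorem exists_limitLaw_of_densityChain (hβ : ∀ K, 0 ≤ S.β K) {δ : ℕ → ℝ}
    (h : DensityChain F.effLaw δ) (hδ : Summable δ) :
    ∃ ν : Measure X, IsProbabilityMeasure ν ∧ ν ≪ F.effLaw 0 ∧
      ∀ (K : ℕ) (B : ℝ) (g : X → ℝ), Measurable g → (∀ u, |g u| ≤ B) →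
        |∫ u, g u ∂(F.effLaw K) - ∫ u, g u ∂ν| ≤ B * ∑' j, δ (j + K) := by
  haveI : ∀ K, IsProbabilityMeasure (F.effLaw K) := fun K => F.isProbabilityMeasure_effLaw hβ K
  exact h.exists_limit_measure hδ

/-- **THE CONTINUUM LIMIT IDENTIFIED AS AN EXPECTATION UNDER THE LIMITING LAW**: under a summable density chain the
unit-scale averaged expectations `⟨∏_{o ∈ os} W_o⟩_K` converge, for every string `os`, to `∫ ∏ W_o dν` — the moments
of ONE probability measure `ν` on unit-lattice fields; in particular `HasContinuumLimit S`. [folklore] -/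
theorem exists_limitLaw_tendsto_expectAt (hβ : ∀ K, 0 ≤ S.β K) (hm : ∀ K o, Measurable (S.obs K o))
    {δ : ℕ → ℝ} (h : DensityChain F.effLaw δ) (hδ : Summable δ) :
    ∃ ν : Measure X, IsProbabilityMeasure ν ∧ ν ≪ F.effLaw 0 ∧
      ∀ os : List O, Tendsto (fun K => S.expectAt K os) atTop (𝓝 (∫ u, monomial os (F.wVec u) ∂ν)) := by
  obtain ⟨ν, hν, hac, hb⟩ := exists_limitLaw_of_densityChain F hβ h hδ
  refine ⟨ν, hν, hac, fun os => ?_⟩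
  have hmeas : Measurable fun u => monomial os (F.wVec u) := (measurable_monomial os).comp F.measurable_wVec
  have hbd : ∀ K, |S.expectAt K os - ∫ u, monomial os (F.wVec u) ∂ν| ≤ ∑' j, δ (j + K) := by
    intro K
    rw [F.expectAt_eq_integral_effLaw hβ hm F.abs_obs_le_one K os]
    simpa only [one_mul] using hb K 1 (fun u => monomial os (F.wVec u)) hmeas (fun u => abs_monomial_le_one os _)
  have ht : Tendsto (fun K => ∑' j, δ (j + K)) atTop (𝓝 0) := tendsto_sum_nat_add δ
  have hz : Tendsto (fun K => S.expectAt K os - ∫ u, monomial os (F.wVec u) ∂ν) atTop (𝓝 0) :=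
    squeeze_zero_norm (fun K => by rw [Real.norm_eq_abs]; exact hbd K) ht
  exact tendsto_sub_nhds_zero_iff.mp hz

/-- **Summable density chain ⇒ the apex**, through the limiting law. [folklore] -/
theorem hasContinuumLimit_of_densityChain (hβ : ∀ K, 0 ≤ S.β K) (hm : ∀ K o, Measurable (S.obs K o))
    {δ : ℕ → ℝ} (h : DensityChain F.effLaw δ) (hδ : Summable δ) : HasContinuumLimit S := by
  obtain ⟨ν, -, -, hν⟩ := exists_limitLaw_tendsto_expectAt F hβ hm h hδ
  exact fun os => ⟨_, hν os⟩

/-- **NE7-A with `Σ σ_K < ∞` ⇒ the limiting effective unit-lattice law** (TV limit, tail rate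
`2e^{2R} Σ_{j ≥ K} σ_j`). [folklore] -/
theorem exists_limitLaw_of_effTiltRate (hβ : ∀ K, 0 ≤ S.β K) {R : ℝ} {σ : ℕ → ℝ}
    (hσ : Summable σ) (h : F.EffTiltRate R σ) :
    ∃ ν : Measure X, IsProbabilityMeasure ν ∧ ν ≪ F.effLaw 0 ∧
      ∀ (K : ℕ) (B : ℝ) (g : X → ℝ), Measurable g → (∀ u, |g u| ≤ B) →
        |∫ u, g u ∂(F.effLaw K) - ∫ u, g u ∂ν| ≤ B * ∑' j, 2 * Real.exp (2 * R) * σ (j + K) :=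
  exists_limitLaw_of_densityChain F hβ (densityChain_of_effTiltRate F hβ h) (hσ.mul_left _)

/-- **NE7-A′ with summable `σ, w, w'` ⇒ the limiting effective unit-lattice law** (TV limit, tail rate
`Σ_{j ≥ K} (4e^{2R} σ_j + 2(w_j + w'_j))`). [folklore] -/
theorem exists_limitLaw_of_effTiltRateGB (hβ : ∀ K, 0 ≤ S.β K) {R : ℝ} {σ w w' : ℕ → ℝ}
    (hσ : Summable σ) (hw : Summable w) (hw' : Summable w') (h : F.EffTiltRateGB R σ w w') :
    ∃ ν : Measure X, IsProbabilityMeasure ν ∧ ν ≪ F.effLaw 0 ∧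
      ∀ (K : ℕ) (B : ℝ) (g : X → ℝ), Measurable g → (∀ u, |g u| ≤ B) →
        |∫ u, g u ∂(F.effLaw K) - ∫ u, g u ∂ν|
          ≤ B * ∑' j, (4 * Real.exp (2 * R) * σ (j + K) + 2 * (w (j + K) + w' (j + K))) :=
  exists_limitLaw_of_densityChain F hβ (densityChain_of_effTiltRateGB F hβ h)
    ((hσ.mul_left _).add ((hw.add hw').mul_left _))

/-- **NE7-D with summable `s, w, w'` ⇒ the limiting effective unit-lattice law.** [folklore] -/
theorem exists_limitLaw_of_effDensityRate (hβ : ∀ K, 0 ≤ S.β K) {s w w' : ℕ → ℝ}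
    (hs : Summable s) (hw : Summable w) (hw' : Summable w') (h : F.EffDensityRate s w w') :
    ∃ ν : Measure X, IsProbabilityMeasure ν ∧ ν ≪ F.effLaw 0 ∧
      ∀ (K : ℕ) (B : ℝ) (g : X → ℝ), Measurable g → (∀ u, |g u| ≤ B) →
        |∫ u, g u ∂(F.effLaw K) - ∫ u, g u ∂ν| ≤ B * ∑' j, (s (j + K) + w (j + K) + w' (j + K)) :=
  exists_limitLaw_of_densityChain F hβ (densityChain_of_effDensityRate F hβ h) ((hs.add hw).add hw')

/-! ## §3 On the observable cube: `law_K → (wVec)_* ν` in total variation; the limit law of `T4LimitLaw` identified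

(Cube-side TV convergence under the density / TV currencies: first recorded by `T4ContinuumLawTV` — see the header's
PRIORITY / OVERLAP note; new here is only the identification of the limit as a push-forward of the law `ν` on `X`.) -/

/-- **TOTAL-VARIATION CONVERGENCE OF THE LAWS OF THE OBSERVABLE VECTOR**: under a summable density chain the laws
`law_K` of `T4LimitLaw` (push-forwards of the Gibbs measures under the clamped observable vector) converge in total
variation on the cube `[-1,1]^𝒪` to the push-forward `(wVec)_* ν` of the limiting effective law, at the tail rate —
an upgrade of the WEAK convergence that `HasContinuumLimit` alone gives (`T4LimitLaw.hasContinuumLimit_iff_exists_tendsto_law`).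
[folklore] -/
theorem exists_limitLaw_law_tv (hβ : ∀ K, 0 ≤ S.β K) (hm : ∀ K o, Measurable (S.obs K o)) {δ : ℕ → ℝ}
    (h : DensityChain F.effLaw δ) (hδ : Summable δ) :
    ∃ ν : Measure X, IsProbabilityMeasure ν ∧ ν ≪ F.effLaw 0 ∧
      ∀ (K : ℕ) (B : ℝ) (φ : Cube O → ℝ), Measurable φ → (∀ x, |φ x| ≤ B) →
        |∫ x, φ x ∂(law S hβ hm K : Measure (Cube O)) - ∫ x, φ x ∂(ν.map F.wVec)| ≤ B * ∑' j, δ (j + K) := by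
  obtain ⟨ν, hν, hac, hb⟩ := exists_limitLaw_of_densityChain F hβ h hδ
  refine ⟨ν, hν, hac, fun K B φ hφ hB => ?_⟩
  rw [F.toMeasure_law_eq_map hβ hm K, integral_map F.measurable_wVec.aemeasurable hφ.aestronglyMeasurable,
    integral_map F.measurable_wVec.aemeasurable hφ.aestronglyMeasurable]
  exact hb K B (fun u => φ (F.wVec u)) (hφ.comp F.measurable_wVec) fun u => hB _

/-- **THE LIMIT LAW IDENTIFIED** (countable observable class): under a summable density chain, the unique limit law of
`T4LimitLaw.existsUnique_limitLaw` IS the push-forward `(wVec)_* ν` of the limiting effective unit-lattice law, and the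
laws `law_K` converge to it weakly. [folklore] -/
theorem exists_limitLaw_identified [Countable O] (hβ : ∀ K, 0 ≤ S.β K) (hm : ∀ K o, Measurable (S.obs K o))
    {δ : ℕ → ℝ} (h : DensityChain F.effLaw δ) (hδ : Summable δ) :
    ∃ (ν : Measure X) (_ : IsProbabilityMeasure ν), ν ≪ F.effLaw 0 ∧
      Tendsto (law S hβ hm) atTop
        (𝓝 (⟨ν.map F.wVec, Measure.isProbabilityMeasure_map F.measurable_wVec.aemeasurable⟩ : ProbabilityMeasure (Cube O))) ∧
      ∀ ν' : ProbabilityMeasure (Cube O),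
        (∀ os : List O, Tendsto (fun K => S.expectAt K os) atTop (𝓝 (∫ x, monomial os x ∂(ν' : Measure (Cube O))))) →
        (ν' : Measure (Cube O)) = ν.map F.wVec := by
  obtain ⟨ν, hν, hac, hlim⟩ := exists_limitLaw_tendsto_expectAt F hβ hm h hδ
  have hC : HasContinuumLimit S := fun os => ⟨_, hlim os⟩
  let νm : ProbabilityMeasure (Cube O) := ⟨ν.map F.wVec, Measure.isProbabilityMeasure_map F.measurable_wVec.aemeasurable⟩
  have hνm : ∀ os : List O,
      Tendsto (fun K => S.expectAt K os) atTop (𝓝 (∫ x, monomial os x ∂(νm : Measure (Cube O)))) := by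
    intro os
    have hcoe : (νm : Measure (Cube O)) = ν.map F.wVec := rfl
    rw [hcoe, integral_map F.measurable_wVec.aemeasurable (measurable_monomial os).aestronglyMeasurable]
    exact hlim os
  have huniq := existsUnique_limitLaw S hβ hm F.abs_obs_le_one hC
  refine ⟨ν, hν, hac, ?_, fun ν' hν' => ?_⟩
  · obtain ⟨ν₁, hν₁, hν₁l⟩ := exists_tendsto_law_of_hasContinuumLimit S hβ hm F.abs_obs_le_one hC
    have heq : ν₁ = νm := huniq.unique hν₁l hνm
    rw [heq] at hν₁
    exact hν₁
  · have heq : ν' = νm := huniq.unique hν' hνm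
    rw [heq]
    rfl

end Scheme

/-! ## §4 One step of a density chain and the node's carved two-run currency

A density chain moves expectations of bounded functions by at most `B·δ_K` per step (the (L∞,L¹) pairing of
`T4VarianceMatching` §1/§5), hence the log-moment generating functions of any bounded unit-lattice function by at
most `e^{2B}·δ_K`: so EVERY unit-lattice law currency that is a density chain — in particular the plain density rate
NE7-D of `T4VarianceMatching` §5, which §9 of that module does not cover — gives the node's carved hybrid statement
`T4CauchySum.MatchingModConstants 1 l₀ (e^{2l₀}·δ) (schemeZ S os)` with the constants `c_K = log Z_{K+1}(0) −
log Z_K(0)` ONLY (no tilt normalisation), and `T4Assembly.GenFunCauchy S l₀` when `Σ δ_K < ∞`.  For the tilt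
currencies this yields the alternative remainders `2e^{2R+2l₀}σ_K` (NE7-A; versus `e^{4R+2l₀}σ_K` of
`UnitFactorisation.matchingModConstants_of_effTiltRate`) and `e^{2l₀}(4e^{2R}σ_K + 2(w_K + w'_K))` (NE7-A′, with NO
smallness condition on `w'`; versus `4e^{4l₀+2R}(σ_K + w_K + w'_K)` under `w'_K ≤ 1/2` of
`UnitFactorisation.matchingModConstants_of_effTiltRateGB`).  Nothing here is an input: the chain property for
Bałaban's scheme is NOT PRINTED (header). -/

section OneStep

variable {α : Type*} [MeasurableSpace α]

/-- **One step of a density chain in total variation**: `|∫ f dμ_{K+1} − ∫ f dμ_K| ≤ B·δ_K` for every measurable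
`f` with `|f| ≤ B`. [folklore] -/
theorem DensityChain.abs_integral_succ_sub_le {μ : ℕ → Measure α} {δ : ℕ → ℝ} (h : DensityChain μ δ)
    [∀ K, IsProbabilityMeasure (μ K)] (K : ℕ) {B : ℝ} {f : α → ℝ} (hf : Measurable f) (hB : ∀ x, |f x| ≤ B) :
    |∫ x, f x ∂(μ (K + 1)) - ∫ x, f x ∂(μ K)| ≤ B * δ K := by
  have hB0 : 0 ≤ B := by
    rcases isEmpty_or_nonempty α with hα | ⟨⟨x⟩⟩
    · have h1 : (μ K) Set.univ = 1 := measure_univ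
      rw [Set.univ_eq_empty_iff.mpr hα, measure_empty] at h1
      exact absurd h1 zero_ne_one
    · exact (abs_nonneg _).trans (hB x)
  have hfb : ∀ᵐ x ∂(μ K), ‖f x‖ ≤ B := ae_of_all _ fun x => by rw [Real.norm_eq_abs]; exact hB x
  have hi2 : Integrable f (μ K) := Integrable.of_bound hf.aestronglyMeasurable B hfb
  have hi1 : Integrable (fun x => h.step K x * f x) (μ K) :=
    (h.integrable_step K).mul_bdd hf.aestronglyMeasurable hfb
  have hi3 : Integrable (fun x => B * |h.step K x - 1|) (μ K) :=
    ((h.integrable_step K).sub (integrable_const 1)).abs.const_mul B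
  rw [h.succ_eq K, integral_withDensity_ofReal_mul (h.measurable_step K) (h.step_nonneg K) f,
    ← integral_sub hi1 hi2]
  calc |∫ x, (h.step K x * f x - f x) ∂(μ K)|
      ≤ ∫ x, |h.step K x * f x - f x| ∂(μ K) := abs_integral_le_integral_abs
    _ ≤ ∫ x, B * |h.step K x - 1| ∂(μ K) := by
        refine integral_mono_of_nonneg (ae_of_all _ fun x => abs_nonneg _) hi3 (ae_of_all _ fun x => ?_)
        show |h.step K x * f x - f x| ≤ B * |h.step K x - 1|
        have e : h.step K x * f x - f x = (h.step K x - 1) * f x := by ring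
        rw [e, abs_mul, mul_comm]
        exact mul_le_mul_of_nonneg_right (hB x) (abs_nonneg _)
    _ = B * ∫ x, |h.step K x - 1| ∂(μ K) := integral_const_mul _ _
    _ ≤ B * δ K := mul_le_mul_of_nonneg_left (h.integral_abs_step_sub_one_le K) hB0

/-- **Log-moment generating functions under a one-function total-variation bound**: for probability measures
`μ, ν`, a measurable `g` with `|g| ≤ B` and `|∫ e^{g} dν − ∫ e^{g} dμ| ≤ e^{B}·ε`, one has
`|log ∫ e^{g} dν − log ∫ e^{g} dμ| ≤ e^{2B}·ε` (both integrals are `≥ e^{−B}`). [folklore] -/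
theorem abs_log_integral_exp_sub_le_of_tv {μ ν : Measure α} [IsProbabilityMeasure μ] [IsProbabilityMeasure ν]
    {g : α → ℝ} {B ε : ℝ} (hg : Measurable g) (hB : ∀ x, |g x| ≤ B)
    (htv : |∫ x, Real.exp (g x) ∂ν - ∫ x, Real.exp (g x) ∂μ| ≤ Real.exp B * ε) :
    |Real.log (∫ x, Real.exp (g x) ∂ν) - Real.log (∫ x, Real.exp (g x) ∂μ)| ≤ Real.exp (2 * B) * ε := by
  have hε : 0 ≤ ε := nonneg_of_mul_nonneg_right ((abs_nonneg _).trans htv) (Real.exp_pos B)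
  -- lower bound `e^{-B} ≤ ∫ e^{g} dπ` under any probability measure `π`
  have hlow : ∀ (π : Measure α) [IsProbabilityMeasure π], Real.exp (-B) ≤ ∫ x, Real.exp (g x) ∂π := by
    intro π _
    have hi : Integrable (fun x => Real.exp (g x)) π :=
      Integrable.of_bound hg.exp.aestronglyMeasurable (Real.exp B) (ae_of_all _ fun x => by
        rw [Real.norm_eq_abs, Real.abs_exp]; exact Real.exp_le_exp.2 ((le_abs_self _).trans (hB x)))
    calc Real.exp (-B) = ∫ _, Real.exp (-B) ∂π := by simp
      _ ≤ ∫ x, Real.exp (g x) ∂π :=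
          integral_mono (integrable_const _) hi fun x => Real.exp_le_exp.2 (neg_le_of_abs_le (hB x))
  have key : ∀ {a b : ℝ}, Real.exp (-B) ≤ a → Real.exp (-B) ≤ b → |a - b| ≤ Real.exp B * ε →
      Real.log a - Real.log b ≤ Real.exp (2 * B) * ε := by
    intro a b ha hb h
    have ha0 : 0 < a := (Real.exp_pos _).trans_le ha
    have hb0 : 0 < b := (Real.exp_pos _).trans_le hb
    have h1 : a ≤ b + Real.exp B * ε := by linarith [le_abs_self (a - b)]
    have h2 : (1 : ℝ) ≤ b * Real.exp B := by
      have := mul_le_mul_of_nonneg_right hb (Real.exp_pos B).le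
      rwa [← Real.exp_add, neg_add_cancel, Real.exp_zero] at this
    have h3 : Real.exp B * ε ≤ b * (Real.exp (2 * B) * ε) := by
      have e : b * (Real.exp (2 * B) * ε) = (b * Real.exp B) * (Real.exp B * ε) := by
        rw [two_mul, Real.exp_add]; ring
      rw [e]
      exact le_mul_of_one_le_left (mul_nonneg (Real.exp_pos B).le hε) h2
    have h4 : a ≤ b * Real.exp (Real.exp (2 * B) * ε) :=
      calc a ≤ b + b * (Real.exp (2 * B) * ε) := by linarith
        _ = b * (Real.exp (2 * B) * ε + 1) := by ring
        _ ≤ b * Real.exp (Real.exp (2 * B) * ε) :=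
            mul_le_mul_of_nonneg_left (Real.add_one_le_exp _) hb0.le
    have h5 := Real.log_le_log ha0 h4
    rw [Real.log_mul hb0.ne' (Real.exp_pos _).ne', Real.log_exp] at h5
    linarith
  exact abs_sub_le_iff.2 ⟨key (hlow ν) (hlow μ) htv, key (hlow μ) (hlow ν) (by rw [abs_sub_comm]; exact htv)⟩

end OneStep

section SchemeCarved

variable {G : Type*} {O : Type*} {S : TorusScheme G O} [MeasurableSpace G] {X : Type*} [MeasurableSpace X]
  (F : UnitFactorisation S X) [GaugeGroup G] [HaarData G] [RegularGaugeGroup G]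

/-- **A density chain of effective laws ⇒ NE7 AS CARVED (the hybrid currency of node U5), per string**, with
`vol = 1`, remainder `e^{2l₀}·δ_K` on `|t| ≤ l₀`, and the constants `c_K = log Z_{K+1}(0) − log Z_K(0)` only: the
dressed partition functions `Z_K(t) = ∫ e^{t ∏_{os} obs_K} e^{−β_K A}` of consecutive runs match modulo constants in
the sense of `T4CauchySum.MatchingModConstants`.  One step of the chain moves `∫ e^{t∏W} dρ_K dV` by at most
`e^{l₀}δ_K` and both integrals are `≥ e^{−l₀}`. [folklore] -/
theorem matchingModConstants_of_densityChain (hβ : ∀ K, 0 ≤ S.β K) (hm : ∀ K o, Measurable (S.obs K o))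
    {δ : ℕ → ℝ} (h : DensityChain F.effLaw δ) {l₀ : ℝ} (hl₀ : 0 ≤ l₀) (os : List O) :
    T4CauchySum.MatchingModConstants 1 l₀ (fun K => Real.exp (2 * l₀) * δ K) (T4GenFunBounds.schemeZ S os) := by
  haveI : ∀ K, IsProbabilityMeasure (F.effLaw K) := fun K => F.isProbabilityMeasure_effLaw hβ K
  intro K
  refine ⟨Real.log (T4GenFunBounds.schemeZ S os (K + 1) 0) - Real.log (T4GenFunBounds.schemeZ S os K 0),
    fun t ht => ?_⟩
  have hgm : Measurable fun u => t * monomial os (F.wVec u) :=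
    ((measurable_monomial os).comp F.measurable_wVec).const_mul t
  have hgB : ∀ u, |t * monomial os (F.wVec u)| ≤ l₀ := fun u => by
    rw [abs_mul]
    calc |t| * |monomial os (F.wVec u)| ≤ l₀ * 1 :=
          mul_le_mul ht (abs_monomial_le_one os _) (abs_nonneg _) hl₀
      _ = l₀ := mul_one _
  have hstep : |∫ u, Real.exp (t * monomial os (F.wVec u)) ∂(F.effLaw (K + 1)) -
      ∫ u, Real.exp (t * monomial os (F.wVec u)) ∂(F.effLaw K)| ≤ Real.exp l₀ * δ K :=
    h.abs_integral_succ_sub_le K hgm.exp fun u => by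
      rw [Real.abs_exp]; exact Real.exp_le_exp.2 ((le_abs_self _).trans (hgB u))
  have key := abs_log_integral_exp_sub_le_of_tv (μ := F.effLaw K) (ν := F.effLaw (K + 1)) hgm hgB hstep
  rw [← F.genFun_schemeZ_eq_log_integral_effLaw hβ hm (K + 1) os t,
    ← F.genFun_schemeZ_eq_log_integral_effLaw hβ hm K os t, T4CauchySum.genFun, T4CauchySum.genFun] at key
  have e : Real.log (T4GenFunBounds.schemeZ S os (K + 1) t) - Real.log (T4GenFunBounds.schemeZ S os K t) -
      (Real.log (T4GenFunBounds.schemeZ S os (K + 1) 0) - Real.log (T4GenFunBounds.schemeZ S os K 0)) =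
      Real.log (T4GenFunBounds.schemeZ S os (K + 1) t) - Real.log (T4GenFunBounds.schemeZ S os (K + 1) 0) -
        (Real.log (T4GenFunBounds.schemeZ S os K t) - Real.log (T4GenFunBounds.schemeZ S os K 0)) := by
    ring
  rw [e, one_mul]
  exact key

/-- **A SUMMABLE density chain of effective laws ⇒ node U0's input `GenFunCauchy S l₀`** for every `l₀ ≥ 0`
(through the tree's `T4Assembly.genFunCauchy_of_matchingModConstants`). [folklore] -/
theorem genFunCauchy_of_densityChain (hβ : ∀ K, 0 ≤ S.β K) (hm : ∀ K o, Measurable (S.obs K o))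
    {δ : ℕ → ℝ} (h : DensityChain F.effLaw δ) (hδ : Summable δ) {l₀ : ℝ} (hl₀ : 0 ≤ l₀) :
    T4Assembly.GenFunCauchy S l₀ :=
  T4Assembly.genFunCauchy_of_matchingModConstants S hl₀ fun os =>
    ⟨1, _, hδ.mul_left (Real.exp (2 * l₀)), matchingModConstants_of_densityChain F hβ hm h hl₀ os⟩

/-- **NE7-D (the plain density rate of `T4VarianceMatching` §5) ⇒ NE7 AS CARVED, per string** (`vol = 1`,
`δ_K ↦ e^{2l₀}(s_K + w_K + w'_K)`): the density-level reading of the hybrid currency sits UPSTREAM of the carved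
statement too (not covered by `T4VarianceMatching` §9, which treats the tilt currencies). [folklore] -/
theorem matchingModConstants_of_effDensityRate (hβ : ∀ K, 0 ≤ S.β K) (hm : ∀ K o, Measurable (S.obs K o))
    {s w w' : ℕ → ℝ} (h : F.EffDensityRate s w w') {l₀ : ℝ} (hl₀ : 0 ≤ l₀) (os : List O) :
    T4CauchySum.MatchingModConstants 1 l₀ (fun K => Real.exp (2 * l₀) * (s K + w K + w' K))
      (T4GenFunBounds.schemeZ S os) :=
  matchingModConstants_of_densityChain F hβ hm (densityChain_of_effDensityRate F hβ h) hl₀ os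

/-- **NE7-D with summable rates ⇒ `GenFunCauchy S l₀`.** [folklore] -/
theorem genFunCauchy_of_effDensityRate (hβ : ∀ K, 0 ≤ S.β K) (hm : ∀ K o, Measurable (S.obs K o))
    {s w w' : ℕ → ℝ} (hs : Summable s) (hw : Summable w) (hw' : Summable w') (h : F.EffDensityRate s w w')
    {l₀ : ℝ} (hl₀ : 0 ≤ l₀) : T4Assembly.GenFunCauchy S l₀ :=
  genFunCauchy_of_densityChain F hβ hm (densityChain_of_effDensityRate F hβ h) ((hs.add hw).add hw') hl₀

/-- **NE7-A ⇒ NE7 AS CARVED with the alternative remainder `e^{2l₀}·2e^{2R}σ_K`** (versus `e^{4R+2l₀}σ_K` of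
`UnitFactorisation.matchingModConstants_of_effTiltRate`; better iff `e^{2R} > 2`). [folklore] -/
theorem matchingModConstants_of_effTiltRate' (hβ : ∀ K, 0 ≤ S.β K) (hm : ∀ K o, Measurable (S.obs K o))
    {R : ℝ} {σ : ℕ → ℝ} (h : F.EffTiltRate R σ) {l₀ : ℝ} (hl₀ : 0 ≤ l₀) (os : List O) :
    T4CauchySum.MatchingModConstants 1 l₀ (fun K => Real.exp (2 * l₀) * (2 * Real.exp (2 * R) * σ K))
      (T4GenFunBounds.schemeZ S os) :=
  matchingModConstants_of_densityChain F hβ hm (densityChain_of_effTiltRate F hβ h) hl₀ os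

/-- **NE7-A′ ⇒ NE7 AS CARVED with NO smallness condition on the image bad weight `w'`**, remainder
`e^{2l₀}(4e^{2R}σ_K + 2(w_K + w'_K))` (versus `4e^{4l₀+2R}(σ_K + w_K + w'_K)` under `w'_K ≤ 1/2` of
`UnitFactorisation.matchingModConstants_of_effTiltRateGB`). [folklore] -/
theorem matchingModConstants_of_effTiltRateGB' (hβ : ∀ K, 0 ≤ S.β K) (hm : ∀ K o, Measurable (S.obs K o))
    {R : ℝ} {σ w w' : ℕ → ℝ} (h : F.EffTiltRateGB R σ w w') {l₀ : ℝ} (hl₀ : 0 ≤ l₀) (os : List O) :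
    T4CauchySum.MatchingModConstants 1 l₀
      (fun K => Real.exp (2 * l₀) * (4 * Real.exp (2 * R) * σ K + 2 * (w K + w' K)))
      (T4GenFunBounds.schemeZ S os) :=
  matchingModConstants_of_densityChain F hβ hm (densityChain_of_effTiltRateGB F hβ h) hl₀ os

/-- **NE7-A′ with summable `σ, w, w'` ⇒ `GenFunCauchy S l₀`, no smallness condition on `w'`.** [folklore] -/
theorem genFunCauchy_of_effTiltRateGB' (hβ : ∀ K, 0 ≤ S.β K) (hm : ∀ K o, Measurable (S.obs K o))
    {R : ℝ} {σ w w' : ℕ → ℝ} (hσ : Summable σ) (hw : Summable w) (hw' : Summable w')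
    (h : F.EffTiltRateGB R σ w w') {l₀ : ℝ} (hl₀ : 0 ≤ l₀) : T4Assembly.GenFunCauchy S l₀ :=
  genFunCauchy_of_densityChain F hβ hm (densityChain_of_effTiltRateGB F hβ h)
    ((hσ.mul_left (4 * Real.exp (2 * R))).add ((hw.add hw').mul_left 2)) hl₀

end SchemeCarved

/-! ## §5 (v2) TV chains: a summable one-sided set-wise total-variation chain of probability laws has a limiting law

The weakest law-level currency of the cell — pv01's NE7-TV `T4MaximalCoupling.EffTVRate F t`,
`effLaw_K(A) ≤ effLaw_{K+1}(A) + t_K` for every measurable `A` — needs NO densities between consecutive laws.  A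
common dominating probability measure `μ₀ = Σ_K 2^{-(K+1)} μ_K` (`domMeasure`) and the Radon–Nikodym densities
`r_K = dμ_K/dμ₀` (`rnDens`) reduce it to §1: the one-sided set bound is two-sided between probability measures
(`measure_le_add_ofReal_of_forall`) and gives `∫ |r_{K+1} − r_K| dμ₀ ≤ 2 t_K` (`TVChain.lintegral_enorm_rnDens_sub_le`);
the generic engine `exists_limit_measure_of_withDensity` then yields a limiting probability law `ν ≪ μ₀` with
`|∫ f dμ_K − ∫ f dν| ≤ B · Σ_{j ≥ K} 2 t_j` for every measurable `|f| ≤ B` (`TVChain.exists_limit_measure`).  A density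
chain is a TV chain with the same rates (`DensityChain.tvChain`), so the TV chain is the weakest of all the currencies. -/

section TVChainSec

variable {α : Type*} [MeasurableSpace α]

/-- **GENERIC LIMIT LAW FROM DENSITIES WITH RESPECT TO A FIXED BASE MEASURE**: probability measures
`μ_K = r_K · μ₀` (`r_K ≥ 0` measurable) whose densities have summable `L¹(μ₀)` increments,
`∫⁻ ‖r_{K+1} − r_K‖ₑ dμ₀ ≤ e_K`, `Σ e_K < ∞`, converge in total variation at the tail rate to a probability measure
`ν ≪ μ₀`: `|∫ f dμ_K − ∫ f dν| ≤ B · Σ_{j ≥ K} e_j` for every measurable `|f| ≤ B`. [folklore] -/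
theorem exists_limit_measure_of_withDensity (μ₀ : Measure α) (μ : ℕ → Measure α)
    [∀ K, IsProbabilityMeasure (μ K)] (r : ℕ → α → ℝ) (hrm : ∀ K, Measurable (r K)) (hr0 : ∀ K x, 0 ≤ r K x)
    (hμ : ∀ K, μ K = μ₀.withDensity (fun x => ENNReal.ofReal (r K x))) (e : ℕ → ℝ) (he0 : ∀ K, 0 ≤ e K)
    (he : ∀ K, ∫⁻ x, ‖r (K + 1) x - r K x‖ₑ ∂μ₀ ≤ ENNReal.ofReal (e K)) (hes : Summable e) :
    ∃ ν : Measure α, IsProbabilityMeasure ν ∧ ν ≪ μ₀ ∧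
      ∀ (K : ℕ) (B : ℝ) (f : α → ℝ), Measurable f → (∀ x, |f x| ≤ B) →
        |∫ x, f x ∂(μ K) - ∫ x, f x ∂ν| ≤ B * ∑' j, e (j + K) := by
  -- normalisation and integrability of the densities
  have hlin : ∀ K, ∫⁻ x, ENNReal.ofReal (r K x) ∂μ₀ = 1 := fun K => by
    have h1 : (μ K) Set.univ = 1 := measure_univ
    rwa [hμ K, withDensity_apply _ MeasurableSet.univ, Measure.restrict_univ] at h1
  have hint : ∀ K, Integrable (r K) μ₀ := fun K => by
    refine ⟨(hrm K).aestronglyMeasurable, ?_⟩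
    have h1 : ∫⁻ x, ‖r K x‖ₑ ∂μ₀ = 1 := by
      rw [← hlin K]
      exact lintegral_congr fun x => Real.enorm_eq_ofReal (hr0 K x)
    show ∫⁻ x, ‖r K x‖ₑ ∂μ₀ < ∞
    rw [h1]
    exact ENNReal.one_lt_top
  have hone : ∀ K, ∫ x, r K x ∂μ₀ = 1 := fun K => by
    rw [integral_eq_lintegral_of_nonneg_ae (ae_of_all _ (hr0 K)) (hrm K).aestronglyMeasurable, hlin K,
      ENNReal.toReal_one]
  have hes' : ∑' K, ENNReal.ofReal (e K) ≠ ∞ := by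
    rw [← ENNReal.ofReal_tsum_of_nonneg he0 hes]
    exact ENNReal.ofReal_ne_top
  obtain ⟨ρ₁, hρ₁m, hlim₁, htail₁⟩ := exists_ae_limit_of_summable_lintegral μ₀ r hrm
    (fun K => ENNReal.ofReal (e K)) he hes'
  -- the nonnegative version `max ρ₁ 0` of the a.e. limit
  have hρm : Measurable fun x => max (ρ₁ x) 0 := hρ₁m.max measurable_const
  have hnn₁ : ∀ᵐ x ∂μ₀, 0 ≤ ρ₁ x := by
    filter_upwards [hlim₁] with x hx
    exact ge_of_tendsto' hx fun K => hr0 K x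
  have hae : ∀ᵐ x ∂μ₀, max (ρ₁ x) 0 = ρ₁ x := by
    filter_upwards [hnn₁] with x hx
    exact max_eq_left hx
  have hshift : ∀ K, Summable fun j => e (j + K) := fun K => (summable_nat_add_iff K).mpr hes
  have htail : ∀ K, ∫⁻ x, ‖r K x - max (ρ₁ x) 0‖ₑ ∂μ₀ ≤ ENNReal.ofReal (∑' j, e (j + K)) := by
    intro K
    rw [ENNReal.ofReal_tsum_of_nonneg (fun j => he0 (j + K)) (hshift K)]
    calc ∫⁻ x, ‖r K x - max (ρ₁ x) 0‖ₑ ∂μ₀ = ∫⁻ x, ‖r K x - ρ₁ x‖ₑ ∂μ₀ := by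
          refine lintegral_congr_ae ?_
          filter_upwards [hae] with x hx
          rw [hx]
      _ ≤ ∑' j, ENNReal.ofReal (e (j + K)) := htail₁ K
  have hint_diff : ∀ K, Integrable (fun x => r K x - max (ρ₁ x) 0) μ₀ := fun K =>
    ⟨((hrm K).sub hρm).aestronglyMeasurable, lt_of_le_of_lt (htail K) ENNReal.ofReal_lt_top⟩
  have hintinf : Integrable (fun x => max (ρ₁ x) 0) μ₀ := by
    have h0 := (hint 0).sub (hint_diff 0)
    refine h0.congr (ae_of_all _ fun x => ?_)
    simp only [Pi.sub_apply, sub_sub_cancel]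
  have hL1 : ∀ K, ∫ x, |r K x - max (ρ₁ x) 0| ∂μ₀ ≤ ∑' j, e (j + K) := by
    intro K
    have h0 : 0 ≤ ∑' j, e (j + K) := tsum_nonneg fun j => he0 (j + K)
    have h1 : ∫ x, |r K x - max (ρ₁ x) 0| ∂μ₀ = (∫⁻ x, ‖r K x - max (ρ₁ x) 0‖ₑ ∂μ₀).toReal := by
      rw [← ofReal_integral_norm_eq_lintegral_enorm (hint_diff K),
        ENNReal.toReal_ofReal (integral_nonneg fun x => norm_nonneg _)]
      simp only [Real.norm_eq_abs]
    rw [h1]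
    exact ENNReal.toReal_le_of_le_ofReal h0 (htail K)
  have honeinf : ∫ x, max (ρ₁ x) 0 ∂μ₀ = 1 := by
    have hb : ∀ K, |1 - ∫ x, max (ρ₁ x) 0 ∂μ₀| ≤ ∑' j, e (j + K) := by
      intro K
      calc |1 - ∫ x, max (ρ₁ x) 0 ∂μ₀|
          = |∫ x, (r K x - max (ρ₁ x) 0) ∂μ₀| := by
            rw [integral_sub (hint K) hintinf, hone K]
        _ ≤ ∫ x, |r K x - max (ρ₁ x) 0| ∂μ₀ := abs_integral_le_integral_abs
        _ ≤ ∑' j, e (j + K) := hL1 K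
    have ht : Tendsto (fun K => ∑' j, e (j + K)) atTop (𝓝 0) := tendsto_sum_nat_add e
    have hle : |1 - ∫ x, max (ρ₁ x) 0 ∂μ₀| ≤ 0 := ge_of_tendsto' ht hb
    have h0 : 1 - ∫ x, max (ρ₁ x) 0 ∂μ₀ = 0 := abs_eq_zero.mp (le_antisymm hle (abs_nonneg _))
    linarith
  -- the limit measure
  refine ⟨μ₀.withDensity (fun x => ENNReal.ofReal (max (ρ₁ x) 0)), ⟨?_⟩, withDensity_absolutelyContinuous _ _, ?_⟩
  · rw [withDensity_apply _ MeasurableSet.univ, Measure.restrict_univ,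
      ← ofReal_integral_eq_lintegral_ofReal hintinf (ae_of_all _ fun x => le_max_right _ _), honeinf,
      ENNReal.ofReal_one]
  · intro K B f hf hB
    have hB0 : 0 ≤ B := by
      rcases isEmpty_or_nonempty α with hα | ⟨⟨x⟩⟩
      · have h1 : (μ K) Set.univ = 1 := measure_univ
        rw [Set.univ_eq_empty_iff.mpr hα, measure_empty] at h1
        exact absurd h1 zero_ne_one
      · exact (abs_nonneg _).trans (hB x)
    have hfb : ∀ᵐ x ∂μ₀, ‖f x‖ ≤ B := ae_of_all _ fun x => by rw [Real.norm_eq_abs]; exact hB x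
    have hi1 : Integrable (fun x => r K x * f x) μ₀ := (hint K).mul_bdd hf.aestronglyMeasurable hfb
    have hi2 : Integrable (fun x => max (ρ₁ x) 0 * f x) μ₀ := hintinf.mul_bdd hf.aestronglyMeasurable hfb
    have hi3 : Integrable (fun x => B * |r K x - max (ρ₁ x) 0|) μ₀ := ((hint K).sub hintinf).abs.const_mul B
    rw [hμ K, integral_withDensity_ofReal_mul (hrm K) (hr0 K) f,
      integral_withDensity_ofReal_mul hρm (fun x => le_max_right _ _) f, ← integral_sub hi1 hi2]
    calc |∫ x, (r K x * f x - max (ρ₁ x) 0 * f x) ∂μ₀|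
        ≤ ∫ x, |r K x * f x - max (ρ₁ x) 0 * f x| ∂μ₀ := abs_integral_le_integral_abs
      _ ≤ ∫ x, B * |r K x - max (ρ₁ x) 0| ∂μ₀ := by
          refine integral_mono_of_nonneg (ae_of_all _ fun x => abs_nonneg _) hi3 (ae_of_all _ fun x => ?_)
          show |r K x * f x - max (ρ₁ x) 0 * f x| ≤ B * |r K x - max (ρ₁ x) 0|
          rw [← sub_mul, abs_mul, mul_comm]
          exact mul_le_mul_of_nonneg_right (hB x) (abs_nonneg _)
      _ = B * ∫ x, |r K x - max (ρ₁ x) 0| ∂μ₀ := integral_const_mul _ _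
      _ ≤ B * ∑' j, e (j + K) := mul_le_mul_of_nonneg_left (hL1 K) hB0

/-- **A one-sided set-wise bound between probability measures is two-sided**: if `μ(A) ≤ ν(A) + t` for every
measurable `A` then `ν(A) ≤ μ(A) + t` (apply the hypothesis to the complement). [folklore] -/
theorem measure_le_add_ofReal_of_forall {μ ν : Measure α} [IsProbabilityMeasure μ] [IsProbabilityMeasure ν]
    {t : ℝ} (ht : 0 ≤ t) (h : ∀ A : Set α, MeasurableSet A → μ A ≤ ν A + ENNReal.ofReal t)
    {A : Set α} (hA : MeasurableSet A) : ν A ≤ μ A + ENNReal.ofReal t := by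
  have h1 := h Aᶜ hA.compl
  rw [prob_compl_eq_one_sub hA, prob_compl_eq_one_sub hA] at h1
  have hμ : μ A ≠ ∞ := measure_ne_top _ _
  have hν : ν A ≠ ∞ := measure_ne_top _ _
  have hμ1 : μ A ≤ 1 := prob_le_one
  have hν1 : ν A ≤ 1 := prob_le_one
  have hfin : 1 - ν A + ENNReal.ofReal t ≠ ∞ :=
    ENNReal.add_ne_top.mpr ⟨ne_top_of_le_ne_top ENNReal.one_ne_top tsub_le_self, ENNReal.ofReal_ne_top⟩
  have h2 : (1 - μ A).toReal ≤ (1 - ν A).toReal + t := by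
    have h3 := ENNReal.toReal_mono hfin h1
    rwa [ENNReal.toReal_add (ne_top_of_le_ne_top ENNReal.one_ne_top tsub_le_self) ENNReal.ofReal_ne_top,
      ENNReal.toReal_ofReal ht] at h3
  rw [ENNReal.toReal_sub_of_le hμ1 ENNReal.one_ne_top, ENNReal.toReal_sub_of_le hν1 ENNReal.one_ne_top,
    ENNReal.toReal_one] at h2
  have h4 : (ν A).toReal ≤ (μ A).toReal + t := by linarith
  calc ν A = ENNReal.ofReal (ν A).toReal := (ENNReal.ofReal_toReal hν).symm
    _ ≤ ENNReal.ofReal ((μ A).toReal + t) := ENNReal.ofReal_le_ofReal h4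
    _ = μ A + ENNReal.ofReal t := by rw [ENNReal.ofReal_add ENNReal.toReal_nonneg ht, ENNReal.ofReal_toReal hμ]

/-- **One-sided set-wise TV chain** (the shape of pv01's `T4MaximalCoupling.EffTVRate`, abstract): `t_K ≥ 0` and
`μ_K(A) ≤ μ_{K+1}(A) + t_K` for every measurable `A`. [folklore] -/
def TVChain (μ : ℕ → Measure α) (t : ℕ → ℝ) : Prop :=
  ∀ K : ℕ, 0 ≤ t K ∧ ∀ A : Set α, MeasurableSet A → μ K A ≤ μ (K + 1) A + ENNReal.ofReal (t K)

/-- **The common dominating probability measure** `Σ_K 2^{-(K+1)} μ_K` of a sequence of probability measures.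
[folklore] -/
def domMeasure (μ : ℕ → Measure α) : Measure α :=
  Measure.sum fun K => ((2 : ℝ≥0∞)⁻¹) ^ (K + 1) • μ K

/-- The dominating measure on a measurable set. [folklore] -/
theorem domMeasure_apply (μ : ℕ → Measure α) {A : Set α} (hA : MeasurableSet A) :
    domMeasure μ A = ∑' K, (2 : ℝ≥0∞)⁻¹ ^ (K + 1) * μ K A := by
  rw [domMeasure, Measure.sum_apply _ hA]
  simp only [Measure.smul_apply, smul_eq_mul]

/-- `Σ_K 2^{-(K+1)} = 1` in `ℝ≥0∞`. [folklore] -/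
theorem tsum_inv_two_pow_succ : ∑' K : ℕ, (2 : ℝ≥0∞)⁻¹ ^ (K + 1) = 1 := by
  calc ∑' K : ℕ, (2 : ℝ≥0∞)⁻¹ ^ (K + 1) = ∑' K : ℕ, (2 : ℝ≥0∞)⁻¹ ^ K * 2⁻¹ := by simp_rw [pow_succ]
    _ = (∑' K : ℕ, (2 : ℝ≥0∞)⁻¹ ^ K) * 2⁻¹ := ENNReal.tsum_mul_right
    _ = (1 - 2⁻¹)⁻¹ * 2⁻¹ := by rw [ENNReal.tsum_geometric]
    _ = 1 := by rw [ENNReal.one_sub_inv_two, ENNReal.inv_mul_cancel (ENNReal.inv_ne_zero.mpr ENNReal.ofNat_ne_top)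
        (ENNReal.inv_ne_top.mpr two_ne_zero)]

/-- The dominating measure of probability measures is a probability measure. [folklore] -/
instance isProbabilityMeasure_domMeasure (μ : ℕ → Measure α) [∀ K, IsProbabilityMeasure (μ K)] :
    IsProbabilityMeasure (domMeasure μ) :=
  ⟨by
    rw [domMeasure_apply μ MeasurableSet.univ]
    simp only [measure_univ, mul_one]
    exact tsum_inv_two_pow_succ⟩

/-- Each `μ_K` is absolutely continuous with respect to the dominating measure. [folklore] -/
theorem absolutelyContinuous_domMeasure (μ : ℕ → Measure α) (K : ℕ) : μ K ≪ domMeasure μ := by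
  intro A hA0
  have hle : ((2 : ℝ≥0∞)⁻¹ ^ (K + 1) • μ K) A ≤ domMeasure μ A :=
    Measure.le_iff'.1 (Measure.le_sum (fun K => ((2 : ℝ≥0∞)⁻¹) ^ (K + 1) • μ K) K) A
  rw [hA0, Measure.smul_apply, smul_eq_mul, nonpos_iff_eq_zero, mul_eq_zero] at hle
  exact hle.resolve_left (pow_ne_zero _ (ENNReal.inv_ne_zero.mpr ENNReal.ofNat_ne_top))

/-- **The real Radon–Nikodym densities** `r_K = dμ_K / dμ₀` with respect to the dominating measure. [folklore] -/
def rnDens (μ : ℕ → Measure α) (K : ℕ) (x : α) : ℝ := ((μ K).rnDeriv (domMeasure μ) x).toReal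

/-- [folklore] -/
theorem measurable_rnDens (μ : ℕ → Measure α) (K : ℕ) : Measurable (rnDens μ K) :=
  (Measure.measurable_rnDeriv _ _).ennreal_toReal

/-- [folklore] -/
theorem rnDens_nonneg (μ : ℕ → Measure α) (K : ℕ) (x : α) : 0 ≤ rnDens μ K x := ENNReal.toReal_nonneg

/-- `μ_K = r_K · μ₀` (Radon–Nikodym; the densities are a.e. finite). [folklore] -/
theorem eq_withDensity_rnDens (μ : ℕ → Measure α) [∀ K, IsProbabilityMeasure (μ K)] (K : ℕ) :
    μ K = (domMeasure μ).withDensity (fun x => ENNReal.ofReal (rnDens μ K x)) := by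
  calc μ K = (domMeasure μ).withDensity ((μ K).rnDeriv (domMeasure μ)) :=
        (Measure.withDensity_rnDeriv_eq _ _ (absolutelyContinuous_domMeasure μ K)).symm
    _ = (domMeasure μ).withDensity (fun x => ENNReal.ofReal (rnDens μ K x)) := by
        refine withDensity_congr_ae ?_
        filter_upwards [Measure.rnDeriv_ne_top (μ K) (domMeasure μ)] with x hx
        rw [rnDens, ENNReal.ofReal_toReal hx]

/-- `∫_A r_K dμ₀ = μ_K(A)`. [folklore] -/
theorem setLIntegral_rnDens (μ : ℕ → Measure α) [∀ K, IsProbabilityMeasure (μ K)] (K : ℕ) {A : Set α}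
    (hA : MeasurableSet A) : ∫⁻ x in A, ENNReal.ofReal (rnDens μ K x) ∂(domMeasure μ) = μ K A := by
  rw [← withDensity_apply _ hA, ← eq_withDensity_rnDens μ K]

/-- [folklore] -/
theorem integrable_rnDens (μ : ℕ → Measure α) [∀ K, IsProbabilityMeasure (μ K)] (K : ℕ) :
    Integrable (rnDens μ K) (domMeasure μ) :=
  Measure.integrable_toReal_rnDeriv

namespace TVChain

variable {μ : ℕ → Measure α} {t : ℕ → ℝ}

/-- [folklore] -/
theorem nonneg (h : TVChain μ t) (K : ℕ) : 0 ≤ t K := (h K).1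

/-- [folklore] -/
theorem le_succ_add (h : TVChain μ t) (K : ℕ) {A : Set α} (hA : MeasurableSet A) :
    μ K A ≤ μ (K + 1) A + ENNReal.ofReal (t K) :=
  (h K).2 A hA

/-- The reverse one-sided bound (probability measures). [folklore] -/
theorem succ_le_add (h : TVChain μ t) [∀ K, IsProbabilityMeasure (μ K)] (K : ℕ) {A : Set α}
    (hA : MeasurableSet A) : μ (K + 1) A ≤ μ K A + ENNReal.ofReal (t K) :=
  measure_le_add_ofReal_of_forall (h.nonneg K) (h K).2 hA

/-- **The key estimate**: `∫ |r_{K+1} − r_K| dμ₀ ≤ 2 t_K` for the Radon–Nikodym densities with respect to the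
dominating measure (split at `{r_K < r_{K+1}}` and use the set bound in both directions). [folklore] -/
theorem lintegral_enorm_rnDens_sub_le (h : TVChain μ t) [∀ K, IsProbabilityMeasure (μ K)] (K : ℕ) :
    ∫⁻ x, ‖rnDens μ (K + 1) x - rnDens μ K x‖ₑ ∂(domMeasure μ) ≤ ENNReal.ofReal (2 * t K) := by
  have hA : MeasurableSet {x | rnDens μ K x < rnDens μ (K + 1) x} :=
    measurableSet_lt (measurable_rnDens μ K) (measurable_rnDens μ (K + 1))
  -- on the set: `‖r' − r‖ₑ = ofReal r' − ofReal r`; off the set: `= ofReal r − ofReal r'`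
  have hpt1 : ∀ x ∈ {x | rnDens μ K x < rnDens μ (K + 1) x},
      ‖rnDens μ (K + 1) x - rnDens μ K x‖ₑ =
        ENNReal.ofReal (rnDens μ (K + 1) x) - ENNReal.ofReal (rnDens μ K x) := fun x hx => by
    rw [Real.enorm_eq_ofReal (sub_nonneg.mpr (le_of_lt hx)), ENNReal.ofReal_sub _ (rnDens_nonneg μ K x)]
  have hpt2 : ∀ x ∈ {x | rnDens μ K x < rnDens μ (K + 1) x}ᶜ,
      ‖rnDens μ (K + 1) x - rnDens μ K x‖ₑ =
        ENNReal.ofReal (rnDens μ K x) - ENNReal.ofReal (rnDens μ (K + 1) x) := fun x hx => by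
    have hx' : rnDens μ (K + 1) x ≤ rnDens μ K x := not_lt.mp hx
    rw [← enorm_neg, neg_sub, Real.enorm_eq_ofReal (sub_nonneg.mpr hx'),
      ENNReal.ofReal_sub _ (rnDens_nonneg μ (K + 1) x)]
  have h1 : ∫⁻ x in {x | rnDens μ K x < rnDens μ (K + 1) x}, ‖rnDens μ (K + 1) x - rnDens μ K x‖ₑ ∂(domMeasure μ)
      ≤ ENNReal.ofReal (t K) := by
    calc ∫⁻ x in {x | rnDens μ K x < rnDens μ (K + 1) x}, ‖rnDens μ (K + 1) x - rnDens μ K x‖ₑ ∂(domMeasure μ)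
        = ∫⁻ x in {x | rnDens μ K x < rnDens μ (K + 1) x},
            (ENNReal.ofReal (rnDens μ (K + 1) x) - ENNReal.ofReal (rnDens μ K x)) ∂(domMeasure μ) :=
          lintegral_congr_ae ((ae_restrict_iff' hA).mpr (ae_of_all _ hpt1))
      _ = ∫⁻ x in {x | rnDens μ K x < rnDens μ (K + 1) x}, ENNReal.ofReal (rnDens μ (K + 1) x) ∂(domMeasure μ) -
            ∫⁻ x in {x | rnDens μ K x < rnDens μ (K + 1) x}, ENNReal.ofReal (rnDens μ K x) ∂(domMeasure μ) := by
          refine lintegral_sub (measurable_rnDens μ K).ennreal_ofReal ?_ ?_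
          · rw [setLIntegral_rnDens μ K hA]
            exact measure_ne_top _ _
          · exact (ae_restrict_iff' hA).mpr (ae_of_all _ fun x hx => ENNReal.ofReal_le_ofReal (le_of_lt hx))
      _ = μ (K + 1) {x | rnDens μ K x < rnDens μ (K + 1) x} - μ K {x | rnDens μ K x < rnDens μ (K + 1) x} := by
          rw [setLIntegral_rnDens μ (K + 1) hA, setLIntegral_rnDens μ K hA]
      _ ≤ ENNReal.ofReal (t K) := tsub_le_iff_left.mpr (h.succ_le_add K hA)
  have h2 : ∫⁻ x in {x | rnDens μ K x < rnDens μ (K + 1) x}ᶜ, ‖rnDens μ (K + 1) x - rnDens μ K x‖ₑ ∂(domMeasure μ)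
      ≤ ENNReal.ofReal (t K) := by
    calc ∫⁻ x in {x | rnDens μ K x < rnDens μ (K + 1) x}ᶜ, ‖rnDens μ (K + 1) x - rnDens μ K x‖ₑ ∂(domMeasure μ)
        = ∫⁻ x in {x | rnDens μ K x < rnDens μ (K + 1) x}ᶜ,
            (ENNReal.ofReal (rnDens μ K x) - ENNReal.ofReal (rnDens μ (K + 1) x)) ∂(domMeasure μ) :=
          lintegral_congr_ae ((ae_restrict_iff' hA.compl).mpr (ae_of_all _ hpt2))
      _ = ∫⁻ x in {x | rnDens μ K x < rnDens μ (K + 1) x}ᶜ, ENNReal.ofReal (rnDens μ K x) ∂(domMeasure μ) -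
            ∫⁻ x in {x | rnDens μ K x < rnDens μ (K + 1) x}ᶜ, ENNReal.ofReal (rnDens μ (K + 1) x) ∂(domMeasure μ) := by
          refine lintegral_sub (measurable_rnDens μ (K + 1)).ennreal_ofReal ?_ ?_
          · rw [setLIntegral_rnDens μ (K + 1) hA.compl]
            exact measure_ne_top _ _
          · exact (ae_restrict_iff' hA.compl).mpr (ae_of_all _ fun x hx => ENNReal.ofReal_le_ofReal (not_lt.mp hx))
      _ = μ K {x | rnDens μ K x < rnDens μ (K + 1) x}ᶜ - μ (K + 1) {x | rnDens μ K x < rnDens μ (K + 1) x}ᶜ := by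
          rw [setLIntegral_rnDens μ K hA.compl, setLIntegral_rnDens μ (K + 1) hA.compl]
      _ ≤ ENNReal.ofReal (t K) := tsub_le_iff_left.mpr (h.le_succ_add K hA.compl)
  rw [← lintegral_add_compl _ hA]
  calc _ ≤ ENNReal.ofReal (t K) + ENNReal.ofReal (t K) := add_le_add h1 h2
    _ = ENNReal.ofReal (2 * t K) := by rw [← ENNReal.ofReal_add (h.nonneg K) (h.nonneg K), two_mul]

/-- **One step of a TV chain on bounded functions**: `|∫ f dμ_{K+1} − ∫ f dμ_K| ≤ B · 2t_K` for every measurable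
`|f| ≤ B`. [folklore] -/
theorem abs_integral_succ_sub_le (h : TVChain μ t) [∀ K, IsProbabilityMeasure (μ K)] (K : ℕ) {B : ℝ} {f : α → ℝ}
    (hf : Measurable f) (hB : ∀ x, |f x| ≤ B) :
    |∫ x, f x ∂(μ (K + 1)) - ∫ x, f x ∂(μ K)| ≤ B * (2 * t K) := by
  have hB0 : 0 ≤ B := by
    rcases isEmpty_or_nonempty α with hα | ⟨⟨x⟩⟩
    · have h1 : (μ K) Set.univ = 1 := measure_univ
      rw [Set.univ_eq_empty_iff.mpr hα, measure_empty] at h1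
      exact absurd h1 zero_ne_one
    · exact (abs_nonneg _).trans (hB x)
  have hfb : ∀ᵐ x ∂(domMeasure μ), ‖f x‖ ≤ B := ae_of_all _ fun x => by rw [Real.norm_eq_abs]; exact hB x
  have hi1 : Integrable (fun x => rnDens μ (K + 1) x * f x) (domMeasure μ) :=
    (integrable_rnDens μ (K + 1)).mul_bdd hf.aestronglyMeasurable hfb
  have hi2 : Integrable (fun x => rnDens μ K x * f x) (domMeasure μ) :=
    (integrable_rnDens μ K).mul_bdd hf.aestronglyMeasurable hfb
  have hdi : Integrable (fun x => rnDens μ (K + 1) x - rnDens μ K x) (domMeasure μ) :=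
    (integrable_rnDens μ (K + 1)).sub (integrable_rnDens μ K)
  have hi3 : Integrable (fun x => B * |rnDens μ (K + 1) x - rnDens μ K x|) (domMeasure μ) := hdi.abs.const_mul B
  have hL1 : ∫ x, |rnDens μ (K + 1) x - rnDens μ K x| ∂(domMeasure μ) ≤ 2 * t K := by
    have h1 : ∫ x, |rnDens μ (K + 1) x - rnDens μ K x| ∂(domMeasure μ) =
        (∫⁻ x, ‖rnDens μ (K + 1) x - rnDens μ K x‖ₑ ∂(domMeasure μ)).toReal := by
      rw [← ofReal_integral_norm_eq_lintegral_enorm hdi,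
        ENNReal.toReal_ofReal (integral_nonneg fun x => norm_nonneg _)]
      simp only [Real.norm_eq_abs]
    rw [h1]
    exact ENNReal.toReal_le_of_le_ofReal (mul_nonneg zero_le_two (h.nonneg K)) (h.lintegral_enorm_rnDens_sub_le K)
  rw [eq_withDensity_rnDens μ (K + 1), eq_withDensity_rnDens μ K,
    integral_withDensity_ofReal_mul (measurable_rnDens μ (K + 1)) (rnDens_nonneg μ (K + 1)) f,
    integral_withDensity_ofReal_mul (measurable_rnDens μ K) (rnDens_nonneg μ K) f, ← integral_sub hi1 hi2]
  calc |∫ x, (rnDens μ (K + 1) x * f x - rnDens μ K x * f x) ∂(domMeasure μ)|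
      ≤ ∫ x, |rnDens μ (K + 1) x * f x - rnDens μ K x * f x| ∂(domMeasure μ) := abs_integral_le_integral_abs
    _ ≤ ∫ x, B * |rnDens μ (K + 1) x - rnDens μ K x| ∂(domMeasure μ) := by
        refine integral_mono_of_nonneg (ae_of_all _ fun x => abs_nonneg _) hi3 (ae_of_all _ fun x => ?_)
        show |rnDens μ (K + 1) x * f x - rnDens μ K x * f x| ≤ B * |rnDens μ (K + 1) x - rnDens μ K x|
        rw [← sub_mul, abs_mul, mul_comm]
        exact mul_le_mul_of_nonneg_right (hB x) (abs_nonneg _)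
    _ = B * ∫ x, |rnDens μ (K + 1) x - rnDens μ K x| ∂(domMeasure μ) := integral_const_mul _ _
    _ ≤ B * (2 * t K) := mul_le_mul_of_nonneg_left hL1 hB0

/-- **THE LIMIT MEASURE OF A SUMMABLE TV CHAIN**: probability measures with `μ_K(A) ≤ μ_{K+1}(A) + t_K`,
`Σ t_K < ∞`, converge in total variation at the tail rate `2 Σ_{j ≥ K} t_j` to a probability measure `ν`,
absolutely continuous with respect to the dominating measure `Σ 2^{-(K+1)} μ_K`. [folklore] -/
theorem exists_limit_measure (h : TVChain μ t) [∀ K, IsProbabilityMeasure (μ K)] (ht : Summable t) :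
    ∃ ν : Measure α, IsProbabilityMeasure ν ∧ ν ≪ domMeasure μ ∧
      ∀ (K : ℕ) (B : ℝ) (f : α → ℝ), Measurable f → (∀ x, |f x| ≤ B) →
        |∫ x, f x ∂(μ K) - ∫ x, f x ∂ν| ≤ B * ∑' j, 2 * t (j + K) :=
  exists_limit_measure_of_withDensity (domMeasure μ) μ (rnDens μ) (measurable_rnDens μ) (rnDens_nonneg μ)
    (eq_withDensity_rnDens μ) (fun K => 2 * t K) (fun K => mul_nonneg zero_le_two (h.nonneg K))
    h.lintegral_enorm_rnDens_sub_le (ht.mul_left 2)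

end TVChain

/-- **A density chain is a TV chain with the same rates** (`μ_K(A) − μ_{K+1}(A) = ∫_A (1 − g_K) dμ_K ≤ ∫ |g_K − 1| dμ_K`):
the TV chain is the weakest of the currencies of this file. [folklore] -/
theorem DensityChain.tvChain {μ : ℕ → Measure α} {δ : ℕ → ℝ} (h : DensityChain μ δ)
    [∀ K, IsProbabilityMeasure (μ K)] : TVChain μ δ := by
  intro K
  refine ⟨h.delta_nonneg K, fun A hA => ?_⟩
  have h1 : μ (K + 1) A = ∫⁻ x in A, ENNReal.ofReal (h.step K x) ∂(μ K) := by
    rw [h.succ_eq K, withDensity_apply _ hA]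
  have hpt : ∀ x, (1 : ℝ≥0∞) ≤ ENNReal.ofReal (h.step K x) + ENNReal.ofReal |h.step K x - 1| := fun x => by
    rw [← ENNReal.ofReal_one, ← ENNReal.ofReal_add (h.step_nonneg K x) (abs_nonneg _)]
    refine ENNReal.ofReal_le_ofReal ?_
    have e1 := le_abs_self (1 - h.step K x)
    have e2 := abs_sub_comm (h.step K x) 1
    linarith
  have hi : Integrable (fun x => |h.step K x - 1|) (μ K) := ((h.integrable_step K).sub (integrable_const 1)).abs
  calc μ K A = ∫⁻ x in A, (1 : ℝ≥0∞) ∂(μ K) := by rw [lintegral_one, Measure.restrict_apply_univ]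
    _ ≤ ∫⁻ x in A, (ENNReal.ofReal (h.step K x) + ENNReal.ofReal |h.step K x - 1|) ∂(μ K) :=
        lintegral_mono fun x => hpt x
    _ = ∫⁻ x in A, ENNReal.ofReal (h.step K x) ∂(μ K) + ∫⁻ x in A, ENNReal.ofReal |h.step K x - 1| ∂(μ K) :=
        lintegral_add_left (h.measurable_step K).ennreal_ofReal _
    _ ≤ μ (K + 1) A + ∫⁻ x, ENNReal.ofReal |h.step K x - 1| ∂(μ K) := by
        rw [← h1]
        exact add_le_add le_rfl (setLIntegral_le_lintegral _ _)
    _ ≤ μ (K + 1) A + ENNReal.ofReal (δ K) := by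
        refine add_le_add le_rfl ?_
        rw [← ofReal_integral_eq_lintegral_ofReal hi (ae_of_all _ fun x => abs_nonneg _)]
        exact ENNReal.ofReal_le_ofReal (h.integral_abs_step_sub_one_le K)

end TVChainSec

/-! ## §6 (v2) NE7-TV (pv01's `T4MaximalCoupling.EffTVRate`, the weakest law-level currency) ⇒ the limiting
effective law, the continuum limit identified, the carved NE7 and `GenFunCauchy`

`EffTVRate F t` IS a TV chain of the effective laws (definitionally).  With `Σ t_K < ∞`: a limiting probability law
`ν` on `X` with `|∫ g d(effLaw K) − ∫ g dν| ≤ B · 2Σ_{j ≥ K} t_j` (here `ν ≪ Σ 2^{-(K+1)} effLaw_K`; absolute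
continuity with respect to `effLaw 0` is not claimed in this currency), the continuum limit of every string
`= ∫ ∏ W_o dν`, the carved NE7 with remainder `e^{2l₀}·2t_K`, and `GenFunCauchy S l₀`.  The apex itself from
`EffTVRate` is pv01's `T4MaximalCoupling` / `T4ContinuumLawTV` (via maximal coupling and transport); the cube-side TV
convergence `law_K → continuumLaw` is pv01's `T4ContinuumLawTV`.  What is added here is the law ON `X` and the
action-level (carved) consequences.  Hypothesis shape NOT PRINTED for Bałaban's data, like every two-run currency. -/

section SchemeTV

variable {G : Type*} {O : Type*} {S : TorusScheme G O} [MeasurableSpace G] {X : Type*} [MeasurableSpace X]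
  (F : UnitFactorisation S X) [GaugeGroup G] [HaarData G] [RegularGaugeGroup G]

omit [RegularGaugeGroup G] in
/-- **pv01's NE7-TV is a TV chain of the effective laws** (definitional). [folklore] -/
theorem tvChain_of_effTVRate {t : ℕ → ℝ} (h : T4MaximalCoupling.EffTVRate F t) : TVChain F.effLaw t := h

/-- **Every density-type currency implies NE7-TV with the same rates** (`DensityChain.tvChain`). [folklore] -/
theorem effTVRate_of_densityChain (hβ : ∀ K, 0 ≤ S.β K) {δ : ℕ → ℝ} (h : DensityChain F.effLaw δ) :
    T4MaximalCoupling.EffTVRate F δ := by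
  haveI : ∀ K, IsProbabilityMeasure (F.effLaw K) := fun K => F.isProbabilityMeasure_effLaw hβ K
  exact h.tvChain

/-- **NE7-TV with `Σ t_K < ∞` ⇒ THE LIMITING EFFECTIVE UNIT-LATTICE LAW** (total-variation limit, tail rate
`2 Σ_{j ≥ K} t_j`, every bounded measurable unit-lattice function). [folklore] -/
theorem exists_limitLaw_of_effTVRate (hβ : ∀ K, 0 ≤ S.β K) {t : ℕ → ℝ} (h : T4MaximalCoupling.EffTVRate F t)
    (ht : Summable t) :
    ∃ ν : Measure X, IsProbabilityMeasure ν ∧ ν ≪ domMeasure F.effLaw ∧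
      ∀ (K : ℕ) (B : ℝ) (g : X → ℝ), Measurable g → (∀ u, |g u| ≤ B) →
        |∫ u, g u ∂(F.effLaw K) - ∫ u, g u ∂ν| ≤ B * ∑' j, 2 * t (j + K) := by
  haveI : ∀ K, IsProbabilityMeasure (F.effLaw K) := fun K => F.isProbabilityMeasure_effLaw hβ K
  exact (tvChain_of_effTVRate F h).exists_limit_measure ht

/-- **NE7-TV with `Σ t_K < ∞` ⇒ the continuum limit of every string identified as `∫ ∏ W_o dν`.** [folklore] -/
theorem exists_limitLaw_tendsto_expectAt_of_effTVRate (hβ : ∀ K, 0 ≤ S.β K) (hm : ∀ K o, Measurable (S.obs K o))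
    {t : ℕ → ℝ} (h : T4MaximalCoupling.EffTVRate F t) (ht : Summable t) :
    ∃ ν : Measure X, IsProbabilityMeasure ν ∧
      ∀ os : List O, Tendsto (fun K => S.expectAt K os) atTop (𝓝 (∫ u, monomial os (F.wVec u) ∂ν)) := by
  obtain ⟨ν, hν, -, hb⟩ := exists_limitLaw_of_effTVRate F hβ h ht
  refine ⟨ν, hν, fun os => ?_⟩
  have hmeas : Measurable fun u => monomial os (F.wVec u) := (measurable_monomial os).comp F.measurable_wVec
  have hbd : ∀ K, |S.expectAt K os - ∫ u, monomial os (F.wVec u) ∂ν| ≤ ∑' j, 2 * t (j + K) := by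
    intro K
    rw [F.expectAt_eq_integral_effLaw hβ hm F.abs_obs_le_one K os]
    simpa only [one_mul] using hb K 1 (fun u => monomial os (F.wVec u)) hmeas (fun u => abs_monomial_le_one os _)
  have ht0 : Tendsto (fun K => ∑' j, 2 * t (j + K)) atTop (𝓝 0) := tendsto_sum_nat_add fun j => 2 * t j
  have hz : Tendsto (fun K => S.expectAt K os - ∫ u, monomial os (F.wVec u) ∂ν) atTop (𝓝 0) :=
    squeeze_zero_norm (fun K => by rw [Real.norm_eq_abs]; exact hbd K) ht0
  exact tendsto_sub_nhds_zero_iff.mp hz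

/-- **NE7-TV ⇒ NE7 AS CARVED, per string** (`vol = 1`, remainder `e^{2l₀}·2t_K`, constants
`log Z_{K+1}(0) − log Z_K(0)`). [folklore] -/
theorem matchingModConstants_of_effTVRate (hβ : ∀ K, 0 ≤ S.β K) (hm : ∀ K o, Measurable (S.obs K o))
    {t : ℕ → ℝ} (h : T4MaximalCoupling.EffTVRate F t) {l₀ : ℝ} (hl₀ : 0 ≤ l₀) (os : List O) :
    T4CauchySum.MatchingModConstants 1 l₀ (fun K => Real.exp (2 * l₀) * (2 * t K)) (T4GenFunBounds.schemeZ S os) := by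
  haveI : ∀ K, IsProbabilityMeasure (F.effLaw K) := fun K => F.isProbabilityMeasure_effLaw hβ K
  intro K
  refine ⟨Real.log (T4GenFunBounds.schemeZ S os (K + 1) 0) - Real.log (T4GenFunBounds.schemeZ S os K 0),
    fun t' ht' => ?_⟩
  have hgm : Measurable fun u => t' * monomial os (F.wVec u) :=
    ((measurable_monomial os).comp F.measurable_wVec).const_mul t'
  have hgB : ∀ u, |t' * monomial os (F.wVec u)| ≤ l₀ := fun u => by
    rw [abs_mul]
    calc |t'| * |monomial os (F.wVec u)| ≤ l₀ * 1 :=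
          mul_le_mul ht' (abs_monomial_le_one os _) (abs_nonneg _) hl₀
      _ = l₀ := mul_one _
  have hstep : |∫ u, Real.exp (t' * monomial os (F.wVec u)) ∂(F.effLaw (K + 1)) -
      ∫ u, Real.exp (t' * monomial os (F.wVec u)) ∂(F.effLaw K)| ≤ Real.exp l₀ * (2 * t K) :=
    (tvChain_of_effTVRate F h).abs_integral_succ_sub_le K hgm.exp fun u => by
      rw [Real.abs_exp]; exact Real.exp_le_exp.2 ((le_abs_self _).trans (hgB u))
  have key := abs_log_integral_exp_sub_le_of_tv (μ := F.effLaw K) (ν := F.effLaw (K + 1)) hgm hgB hstep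
  rw [← F.genFun_schemeZ_eq_log_integral_effLaw hβ hm (K + 1) os t',
    ← F.genFun_schemeZ_eq_log_integral_effLaw hβ hm K os t', T4CauchySum.genFun, T4CauchySum.genFun] at key
  have e : Real.log (T4GenFunBounds.schemeZ S os (K + 1) t') - Real.log (T4GenFunBounds.schemeZ S os K t') -
      (Real.log (T4GenFunBounds.schemeZ S os (K + 1) 0) - Real.log (T4GenFunBounds.schemeZ S os K 0)) =
      Real.log (T4GenFunBounds.schemeZ S os (K + 1) t') - Real.log (T4GenFunBounds.schemeZ S os (K + 1) 0) -
        (Real.log (T4GenFunBounds.schemeZ S os K t') - Real.log (T4GenFunBounds.schemeZ S os K 0)) := by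
    ring
  rw [e, one_mul]
  exact key

/-- **NE7-TV with `Σ t_K < ∞` ⇒ node U0's input `GenFunCauchy S l₀`** for every `l₀ ≥ 0`. [folklore] -/
theorem genFunCauchy_of_effTVRate (hβ : ∀ K, 0 ≤ S.β K) (hm : ∀ K o, Measurable (S.obs K o))
    {t : ℕ → ℝ} (ht : Summable t) (h : T4MaximalCoupling.EffTVRate F t) {l₀ : ℝ} (hl₀ : 0 ≤ l₀) :
    T4Assembly.GenFunCauchy S l₀ :=
  T4Assembly.genFunCauchy_of_matchingModConstants S hl₀ fun os =>
    ⟨1, _, (ht.mul_left 2).mul_left (Real.exp (2 * l₀)), matchingModConstants_of_effTVRate F hβ hm h hl₀ os⟩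

end SchemeTV


/-! ## §7 Representation by tail bounds: any TV-tail limit represents the continuum limit, and it is unique

If a measure `ν` on `X` satisfies `|∫ g d(effLaw K) − ∫ g dν| ≤ B·a_K` for every bounded measurable `g` (`|g| ≤ B`) with
`a_K → 0` — the shape of the conclusions of §2, §5 and §6 — then every string expectation converges to `∫ ∏ W_o dν`,
`HasContinuumLimit S`, and (countable `𝒪`) the laws `law_K` of `T4LimitLaw` converge weakly to `(wVec)_* ν`; and two
probability measures with such tail bounds are EQUAL.  So the limit law does not depend on the currency that produced it,
and the `∃ ν` of §2/§5/§6 may be used interchangeably in every identification. [folklore] -/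

section Tail

variable {G : Type*} {O : Type*} {S : TorusScheme G O} [MeasurableSpace G] {X : Type*} [MeasurableSpace X]
  (F : UnitFactorisation S X) [GaugeGroup G] [HaarData G] [RegularGaugeGroup G]

omit [RegularGaugeGroup G] in
/-- Tail bounds with `a_K → 0` give convergence of `∫ g d(effLaw K)` for every bounded measurable `g`. [folklore] -/
theorem tendsto_integral_effLaw_of_tail {ν : Measure X} {a : ℕ → ℝ} (ha : Tendsto a atTop (𝓝 0))
    (hb : ∀ (K : ℕ) (B : ℝ) (g : X → ℝ), Measurable g → (∀ u, |g u| ≤ B) →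
      |∫ u, g u ∂(F.effLaw K) - ∫ u, g u ∂ν| ≤ B * a K)
    {B : ℝ} {g : X → ℝ} (hgm : Measurable g) (hgB : ∀ u, |g u| ≤ B) :
    Tendsto (fun K => ∫ u, g u ∂(F.effLaw K)) atTop (𝓝 (∫ u, g u ∂ν)) := by
  have hBa : Tendsto (fun K => B * a K) atTop (𝓝 0) := by simpa using ha.const_mul B
  have hz : Tendsto (fun K => ∫ u, g u ∂(F.effLaw K) - ∫ u, g u ∂ν) atTop (𝓝 0) :=
    squeeze_zero_norm (fun K => by rw [Real.norm_eq_abs]; exact hb K B g hgm hgB) hBa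
  exact tendsto_sub_nhds_zero_iff.mp hz

omit [RegularGaugeGroup G] in
/-- **Uniqueness of the limiting law**: two probability measures with tail bounds (`a_K → 0`, `a'_K → 0`) against the same
effective laws are equal. [folklore] -/
theorem eq_of_tail {ν ν' : Measure X} [IsProbabilityMeasure ν] [IsProbabilityMeasure ν'] {a a' : ℕ → ℝ}
    (ha : Tendsto a atTop (𝓝 0))
    (hb : ∀ (K : ℕ) (B : ℝ) (g : X → ℝ), Measurable g → (∀ u, |g u| ≤ B) →
      |∫ u, g u ∂(F.effLaw K) - ∫ u, g u ∂ν| ≤ B * a K)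
    (ha' : Tendsto a' atTop (𝓝 0))
    (hb' : ∀ (K : ℕ) (B : ℝ) (g : X → ℝ), Measurable g → (∀ u, |g u| ≤ B) →
      |∫ u, g u ∂(F.effLaw K) - ∫ u, g u ∂ν'| ≤ B * a' K) :
    ν = ν' := by
  refine Measure.ext fun A hA => ?_
  have hgm : Measurable (A.indicator fun _ => (1 : ℝ)) := measurable_const.indicator hA
  have hgB : ∀ u, |A.indicator (fun _ => (1 : ℝ)) u| ≤ 1 := by
    intro u
    by_cases hu : u ∈ A
    · simp [Set.indicator_of_mem hu]
    · simp [Set.indicator_of_notMem hu]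
  have h1 := tendsto_integral_effLaw_of_tail F ha hb hgm hgB
  have h2 := tendsto_integral_effLaw_of_tail F ha' hb' hgm hgB
  have heq : ∫ u, A.indicator (fun _ => (1 : ℝ)) u ∂ν = ∫ u, A.indicator (fun _ => (1 : ℝ)) u ∂ν' :=
    tendsto_nhds_unique h1 h2
  rw [integral_indicator_const _ hA, integral_indicator_const _ hA, smul_eq_mul, smul_eq_mul, mul_one, mul_one,
    measureReal_def, measureReal_def] at heq
  exact (ENNReal.toReal_eq_toReal_iff' (measure_ne_top ν A) (measure_ne_top ν' A)).mp heq

/-- **Any tail-limit law represents the string limits**: `⟨∏_{o∈os} W_o⟩_K → ∫ ∏ W_o dν`. [folklore] -/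
theorem tendsto_expectAt_of_tail (hβ : ∀ K, 0 ≤ S.β K) (hm : ∀ K o, Measurable (S.obs K o)) {ν : Measure X}
    {a : ℕ → ℝ} (ha : Tendsto a atTop (𝓝 0))
    (hb : ∀ (K : ℕ) (B : ℝ) (g : X → ℝ), Measurable g → (∀ u, |g u| ≤ B) →
      |∫ u, g u ∂(F.effLaw K) - ∫ u, g u ∂ν| ≤ B * a K) (os : List O) :
    Tendsto (fun K => S.expectAt K os) atTop (𝓝 (∫ u, monomial os (F.wVec u) ∂ν)) := by
  have hmeas : Measurable fun u => monomial os (F.wVec u) := (measurable_monomial os).comp F.measurable_wVec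
  have h := tendsto_integral_effLaw_of_tail F ha hb hmeas (fun u => abs_monomial_le_one os _)
  have hfun : (fun K => S.expectAt K os) = fun K => ∫ u, monomial os (F.wVec u) ∂(F.effLaw K) :=
    funext fun K => F.expectAt_eq_integral_effLaw hβ hm F.abs_obs_le_one K os
  rw [hfun]
  exact h

/-- … hence `HasContinuumLimit S`. [folklore] -/
theorem hasContinuumLimit_of_tail (hβ : ∀ K, 0 ≤ S.β K) (hm : ∀ K o, Measurable (S.obs K o)) {ν : Measure X}
    {a : ℕ → ℝ} (ha : Tendsto a atTop (𝓝 0))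
    (hb : ∀ (K : ℕ) (B : ℝ) (g : X → ℝ), Measurable g → (∀ u, |g u| ≤ B) →
      |∫ u, g u ∂(F.effLaw K) - ∫ u, g u ∂ν| ≤ B * a K) : HasContinuumLimit S :=
  fun os => ⟨_, tendsto_expectAt_of_tail F hβ hm ha hb os⟩

omit [GaugeGroup G] [HaarData G] [RegularGaugeGroup G] in
/-- Monomial integrals of the push-forward. [folklore] -/
theorem integral_monomial_map_wVec (ν : Measure X) (os : List O) :
    ∫ x, monomial os x ∂(ν.map F.wVec) = ∫ u, monomial os (F.wVec u) ∂ν :=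
  integral_map F.measurable_wVec.aemeasurable (measurable_monomial os).aestronglyMeasurable

/-- **Any tail-limit law gives the weak limit of the laws on the cube** (countable `𝒪`): `law_K → (wVec)_* ν`. [folklore] -/
theorem tendsto_law_of_tail [Countable O] (hβ : ∀ K, 0 ≤ S.β K) (hm : ∀ K o, Measurable (S.obs K o))
    {ν : Measure X} [IsProbabilityMeasure ν] {a : ℕ → ℝ} (ha : Tendsto a atTop (𝓝 0))
    (hb : ∀ (K : ℕ) (B : ℝ) (g : X → ℝ), Measurable g → (∀ u, |g u| ≤ B) →
      |∫ u, g u ∂(F.effLaw K) - ∫ u, g u ∂ν| ≤ B * a K) :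
    Tendsto (law S hβ hm) atTop
      (𝓝 (⟨ν.map F.wVec, Measure.isProbabilityMeasure_map F.measurable_wVec.aemeasurable⟩ :
        ProbabilityMeasure (Cube O))) := by
  have hlim := tendsto_expectAt_of_tail F hβ hm ha hb
  have hC : HasContinuumLimit S := fun os => ⟨_, hlim os⟩
  let νm : ProbabilityMeasure (Cube O) :=
    ⟨ν.map F.wVec, Measure.isProbabilityMeasure_map F.measurable_wVec.aemeasurable⟩
  have hνm : ∀ os : List O,
      Tendsto (fun K => S.expectAt K os) atTop (𝓝 (∫ x, monomial os x ∂(νm : Measure (Cube O)))) := by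
    intro os
    have hcoe : (νm : Measure (Cube O)) = ν.map F.wVec := rfl
    rw [hcoe, integral_monomial_map_wVec F ν os]
    exact hlim os
  obtain ⟨ν₁, hν₁, hν₁l⟩ := exists_tendsto_law_of_hasContinuumLimit S hβ hm F.abs_obs_le_one hC
  have heq : ν₁ = νm := (existsUnique_limitLaw S hβ hm F.abs_obs_le_one hC).unique hν₁l hνm
  rw [heq] at hν₁
  exact hν₁

end Tail

end Literature.MathematicalPhysics.QuantumFieldTheory.Balaban1983to89.T4EffectiveLawLimit

end
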